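import Literature.NumberTheory.LFunctions.LiCoefficientsModelSpace
import Literature.NumberTheory.LFunctions.KeiperLiZeroSum
import Literature.NumberTheory.LFunctions.BombieriLagariasEtaIdentification
import Literature.NumberTheory.LFunctions.Xiao2020.KeiperLiTaylor
import Literature.NumberTheory.LFunctions.ZetaZeroReciprocalSum
import Literature.NumberTheory.LFunctions.ZetaZerosReflection
import Literature.NumberTheory.LFunctions.FordZetaZeroRecipSqSum
import Literature.NumberTheory.LFunctions.XiTaylor
import Literature.NumberTheory.LFunctions.ZetaLogDerivRePartialFraction
import Literature.NumberTheory.LFunctions.LagariasXiStructureFunction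
import Literature.NumberTheory.LFunctions.RHWave0HardyProofs
import HarnessLib

/-!
# Li coefficients as norms of functions in a model space (Suzuki 2023) — RH-FREE discharges

LINE 1 — LABEL: RH-FREE proofs (and one explicit reduction of an RH-CONSEQUENCE to a named
boundary statement). This file DISCHARGES named statements of
`Literature/NumberTheory/LFunctions/LiCoefficientsModelSpace.lean` (M. Suzuki, *Li coefficients as
norms of functions in a model space*, J. Number Theory 252 (2023) 177–194 = arXiv:2301.05779,
[Su23b]) against the tree: nothing here is worded as, or is, progress toward RH — Theorem 1.1 of
the paper is Li's criterion re-expressed, and the only RH-strength statement (`Suzuki2023b_eq_s301`,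
the model-space identity (3.8) under RH) is NOT proved here. WHAT THIS IS NOT: not a route, not a
proof plan for RH; nothing here bears on the truth of RH.

## What is proved

* `Suzuki2023b_thm11_if_holds` — Thm. 1.1 ⟸ ("trivially … by Li's criterion", p. 2 L113): from
  the tree's `li_criterion_holds` and `‖G_n‖² ≥ 0`.
* `Suzuki2023b_eq_s302_holds` — eq. (3.9): `Σ_{ρ∈𝒵} m_ρ{[1−(1−1/ρ)ⁿ] + [1−(1−1/(1−ρ))ⁿ]} = 2λ_n`
  UNCONDITIONALLY, from `keiperLiCoeff_eq_tsum_zeros` (`λ_n = Σ′ m(ρ) Re[1−(1−1/ρ)ⁿ]`), the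
  symmetries `ρ ↦ 1−ρ`, `ρ ↦ ρ̄` of the zeros with their multiplicities
  (`riemannZetaZeroOrder_one_sub_holds`, `riemannZetaZeroOrder_conj_holds`) and the absolute
  convergence "under the curly brackets" (`[…] + […] = […]·[…]`, cf. (3.7), and
  `Σ m(ρ)/|ρ(1−ρ)| < ∞`, `ZetaZeroSum.summable_norm_zeroOrder_div_mul_one_sub`).
* `Suzuki2023b_thm11_onlyif_of_eq_s301`, `Suzuki2023b_thm11_of_eq_s301` — the printed last line
  of §3.4 ("equality (1.6) follows from (3.8) and (3.9)"): Thm. 1.1 ⟹ and the ⟺ REDUCED to the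
  single boundary statement (3.8) (`Suzuki2023b_eq_s301`, RH-CONSEQUENCE, not proved here).
* `Suzuki2023b_eq_s103_holds` — the `η_k`-dictionary: eq. (1.3) holds with `η_k := liEta k`
  (from `liEta_eq_neg_re_zetaOneLogDerivCoeff`, the reality of the Taylor coefficients of `ζ₁′/ζ₁`
  at `1`, and the Taylor expansion of `ζ₁′/ζ₁` on a disc about `1`).
* `Suzuki2023b_eq0301_1` — the printed shape (1.7) of the arithmetic formula "[BoLa99, Thm 2 and
  (4.1)]", from the tree's `Coffey2005_thm1_holds` (a rewriting, no new content).
* `Suzuki2023b_eq_s212_holds` — eq. (2.9): `ξ(s)/((ξ(s)+ξ′(s))(s−ρ)) → 1/m_ρ` at `ρ ∈ 𝒵`.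
* `Suzuki2023b_lemma21_holds` — Lemma 2.1: absolute convergence of the series of `M_n` off `𝒵`,
  holomorphy off `𝒵`, and the residues `(s−ρ)M_n(s) → −i m_ρ[1−(1−1/ρ)ⁿ]`.
* `liModelHFormula_eq_mul_liModelM` and `Suzuki2023b_prop21_holds` — Prop. 2.1, eq. (2.2):
  `H_n = i ξ/(ξ+ξ′) · M_n`, with the removability of every `ρ ∈ 𝒵`. In place of the printed
  Weil-explicit-formula computation the identity is obtained from Hadamard's partial fractions
  for `ξ′/ξ` (`hasSum_zeroOrder_mul_inv_sub_add_inv`, Titchmarsh (2.12.7)), the power sums over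
  the zeros `Σ_ρ m_ρ ρ^{−k−1} = 1 − [(−1)^k η_k + (1−2^{−k−1})ζ(k+1)]`
  (`hasSum_zeroOrder_mul_inv_pow`, from the tree's `(ξ′/ξ)^{(k)}(1)` series and
  `Coffey2005`/`BombieriLagarias1999` `η`-identification) and finite algebra.
* `Suzuki2023b_eq0225_1_holds` — eq. (3.6): `G_n(z) = Σ_γ m_γ[1−(1−1/(½−iγ))ⁿ]·i(1+Θ(z))/(2(z−γ))`
  pointwise off the zeros of `ξ(½−iz)` and of `E`.
* `Suzuki2023b_prop22_holds` — Prop. 2.2: `G_n|_ℝ` is bounded, real-analytic and in `L²(ℝ)`,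
  unconditionally: analyticity of `H_n` at every point of the critical line
  (`analyticAt_liModelH`, and removability `analyticAt_liModelH_of_mem` by Riemann's theorem),
  the bound `|H_n(½−ix)| ≤ K(n)/|½−ix|` (`norm_liModelH_critical_le`, using `|ξ| ≤ |ξ+ξ′|`,
  `|ξ′| ≤ |ξ+ξ′|` on the line) extended across the isolated critical zeros by continuity.
* `Suzuki2023b_prop23_1_holds`, `Suzuki2023b_prop23_3_holds`, `Suzuki2023b_prop23_5_holds` —
  Prop. 2.3 (1), (3), (5): `H_n` is meromorphic on `ℂ` and real on `ℝ`; analytic wherever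
  `ξ+ξ′ ≠ 0` or `ξ = 0`, and at `0` and `1` (`ξ(0)+ξ′(0) = ½ − β/4`, `ξ(1)+ξ′(1) = ½ + β/4`,
  `β = nicolasBeta ∈ (0.045, 0.0474)`); the zero set of `ξ+ξ′` and the pole set of `H_n` are
  conjugation-closed (`liModelM_conj`, `liModelH_conj`).
* `Suzuki2023b_prop23_4_holds` — Prop. 2.3 (4): a zero `l ∉ 𝒵` of `ξ+ξ′` of order `m` at which
  `M_n` vanishes to order `< m` is a pole of `H_n` (`|H_n| → ∞`).
* `Suzuki2023b_prop23_2_holds` — Prop. 2.3 (2) (`n = 1`): `H_1` is neither real nor purely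
  imaginary on `Re s = ½` — `H_1(ρ) = 1/ρ ∉ ℝ` at a critical zero (Hardy's theorem, proved in the
  tree) and `H_1(½) = β > 0` (`liModelH_one_half`); with the removable values
  `H_n(ρ) = 1 − (1−1/ρ)ⁿ` at `ρ ∈ 𝒵` (`liModelH_of_mem`).
* `Suzuki2023b_mellin_testFun_holds` — `ĝ_n(ρ) = ∫₀^∞ g_n(x)x^{ρ−1}dx = 1 − (1−1/ρ)ⁿ` for
  `Re ρ > 0` ([BoLa99, Lemma 2]): `∫₀¹ (log x)^k x^{s−1}dx = (−1)^k k!/s^{k+1}`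
  (`hasMellin_indicator_log_pow`, by differentiating the Mellin transform of `𝟙_{(0,1]}`).

With these, every RH-FREE named statement of the statements file is discharged; the three
RH-CONSEQUENCE statements (`Suzuki2023b_eq_s301` = (3.8), `Suzuki2023b_thm11_onlyif`,
`Suzuki2023b_thm11`) are reduced here to the single boundary statement (3.8), and (3.8) itself is
discharged in the sibling `Literature/NumberTheory/LFunctions/LiCoefficientsModelSpaceRH.lean`
(LABEL: RH-CONSEQUENCE proofs; `Suzuki2023b_eq_s301_holds`, `Suzuki2023b_thm11_onlyif_holds`,
`Suzuki2023b_thm11_holds`) by the orthogonality relations of the functions `i(1+Θ)/(2(x−γ))` in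
`L²(ℝ)` under RH — so that all seventeen named statements of [Su23b] typed in the tree are proved.

## References
* M. Suzuki, J. Number Theory 252 (2023) 177–194, Thm. 1.1, Lemma 2.1, Prop. 2.1, Prop. 2.2,
  Prop. 2.3, (2.9), §3.4 (3.6), (3.8)–(3.9), (1.3), (1.7), (1.8), §4.2. [Suzuki2023b]
* E. Bombieri, J. C. Lagarias, J. Number Theory 77 (1999), Lemma 2. [BombieriLagarias1999]
* G. H. Hardy, C. R. Acad. Sci. Paris 158 (1914) (zeros on the critical line; the tree's
  `hardy_infinite_zeros_on_critical_line_holds`). [Hardy1914]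
* X.-J. Li, J. Number Theory 65 (1997), Thm. 1. [Li1997]
* E. C. Titchmarsh, The theory of the Riemann zeta-function, 2nd ed. (1986), §2.12 (2.12.7).
  [Titchmarsh1986]
-/

noncomputable section

open Complex Filter Topology Set Finset MeasureTheory
open scoped ComplexConjugate

namespace Literature.NumberTheory.LFunctions

open ZetaZeros

/-! ## Theorem 1.1, the RH-free direction -/

/-- **[Su23b] Thm. 1.1 ⟸ (discharge of `Suzuki2023b_thm11_if`)**: if `λ_n = (2π)^{−1}‖G_n‖²`
for all `n ≥ 1` then RH — "The Riemann hypothesis follows trivially from equation (1.6) by Li's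
criterion": a squared norm is non-negative, and `li_criterion_holds`. RH-FREE.
[cite: Suzuki2023b, Thm. 1.1, p. 2 L100–113] -/
theorem Suzuki2023b_thm11_if_holds : Suzuki2023b_thm11_if := by
  intro h
  refine li_criterion_holds.2 fun n hn ↦ ?_
  rw [h n hn]
  exact mul_nonneg (by positivity) (integral_nonneg fun x ↦ by positivity)

/-! ## Eq. (3.9): `λ_n` as the bracketed zero sum (unconditional) -/

/-- `|1 − (1 − 1/s)ⁿ| ≤ n·2ⁿ/|s|` for `|s| ≥ 1` ("`2 Re[1 − (1−1/(½−iγ))ⁿ] ≪ 1/(¼+γ²)` with an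
implied constant depending only on `n`", p. 8 L124–131, in the crude form we need).
[cite: Suzuki2023b, §3.4, p. 8 L124–131] -/
theorem norm_one_sub_one_sub_inv_pow_le {s : ℂ} (hs : 1 ≤ ‖s‖) (n : ℕ) :
    ‖1 - (1 - 1 / s) ^ n‖ ≤ n * 2 ^ n / ‖s‖ := by
  have hs0 : s ≠ 0 := by
    intro h; rw [h, norm_zero] at hs; exact absurd hs (by norm_num)
  have hspos : 0 < ‖s‖ := norm_pos_iff.mpr hs0
  have hw : ‖1 - 1 / s‖ ≤ 2 := by
    calc ‖1 - 1 / s‖ ≤ ‖(1 : ℂ)‖ + ‖1 / s‖ := norm_sub_le _ _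
      _ ≤ 1 + 1 := by
          rw [norm_one, norm_div, norm_one]
          gcongr
          exact (div_le_one hspos).mpr hs
      _ = 2 := by norm_num
  have key : 1 - (1 - 1 / s) ^ n = 1 / s * ∑ i ∈ Finset.range n, (1 - 1 / s) ^ i := by
    have := geom_sum_mul (1 - 1 / s) n
    linear_combination this
  rw [key, norm_mul, norm_div, norm_one, one_div_mul_eq_div]
  gcongr
  calc ‖∑ i ∈ Finset.range n, (1 - 1 / s) ^ i‖
      ≤ ∑ i ∈ Finset.range n, ‖(1 - 1 / s) ^ i‖ := norm_sum_le _ _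
    _ ≤ ∑ _i ∈ Finset.range n, (2 : ℝ) ^ n := Finset.sum_le_sum fun i hi ↦ by
        rw [norm_pow]
        exact (pow_le_pow_left₀ (norm_nonneg _) hw i).trans
          (pow_le_pow_right₀ (by norm_num) (Finset.mem_range.1 hi).le)
    _ = n * 2 ^ n := by simp

/-- Non-trivial zeros have `|ρ| ≥ 1` (indeed `|Im ρ| > 14`, `FordL33.fourteen_lt_abs_im`).
[folklore] -/
private theorem one_le_norm_of_mem_nontrivialZeros (ρ : riemannZetaNontrivialZeros) :
    1 ≤ ‖(ρ : ℂ)‖ := by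
  have h := FordL33.fourteen_lt_abs_im ρ
  have := Complex.abs_im_le_norm (ρ : ℂ)
  linarith

/-- … and `|1 − ρ| ≥ 1`. [folklore] -/
private theorem one_le_norm_one_sub_of_mem_nontrivialZeros (ρ : riemannZetaNontrivialZeros) :
    1 ≤ ‖1 - (ρ : ℂ)‖ := by
  have h := FordL33.fourteen_lt_abs_im ρ
  have := Complex.abs_im_le_norm (1 - (ρ : ℂ))
  simp only [sub_im, one_im, zero_sub, abs_neg] at this
  linarith

/-- **(3.7) in the form "bracket sum = bracket product"**: for `s ≠ 0, 1`,
`[1 − (1−1/s)ⁿ] + [1 − (1−1/(1−s))ⁿ] = [1 − (1−1/s)ⁿ]·[1 − (1−1/(1−s))ⁿ]`, because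
`1 − 1/(1−s) = (1 − 1/s)^{−1}` (the paper's "since `(1−1/(½+iγ)) = (1−1/(½−iγ))^{−1}`").
[cite: Suzuki2023b, eq. (3.7), p. 8 L108–122] -/
theorem bracket_add_eq_bracket_mul {s : ℂ} (hs0 : s ≠ 0) (hs1 : s ≠ 1) (n : ℕ) :
    (1 - (1 - 1 / s) ^ n) + (1 - (1 - 1 / (1 - s)) ^ n) =
      (1 - (1 - 1 / s) ^ n) * (1 - (1 - 1 / (1 - s)) ^ n) := by
  have hs1' : (1 : ℂ) - s ≠ 0 := sub_ne_zero.mpr (Ne.symm hs1)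
  have hw0 : (1 : ℂ) - 1 / s ≠ 0 := by
    rw [sub_ne_zero, ne_comm, Ne, div_eq_one_iff_eq hs0]; exact Ne.symm hs1
  have hinv : (1 : ℂ) - 1 / (1 - s) = (1 - 1 / s)⁻¹ := by
    field_simp
    ring
  rw [hinv, inv_pow]
  have hac : (1 - 1 / s) ^ n * ((1 - 1 / s) ^ n)⁻¹ = 1 := mul_inv_cancel₀ (pow_ne_zero n hw0)
  linear_combination -hac

/-- The bracketed family of (3.8)/(3.9) is absolutely summable over the zeros ("the right-hand
side converges absolutely under the curly brackets"). RH-FREE.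
[cite: Suzuki2023b, §3.4, p. 8 L124–138 and L157] -/
theorem summable_zeroOrder_mul_bracket (n : ℕ) :
    Summable fun ρ : riemannZetaNontrivialZeros ↦
      (riemannZetaZeroOrder (ρ : ℂ) : ℂ) *
        ((1 - (1 - 1 / (ρ : ℂ)) ^ n) + (1 - (1 - 1 / (1 - (ρ : ℂ))) ^ n)) := by
  have hg := (summable_norm_zeroOrder_div_mul_one_sub).mul_left
    (((n : ℝ) * 2 ^ n) ^ 2)
  refine Summable.of_norm_bounded hg fun ρ ↦ ?_
  have h0 : (ρ : ℂ) ≠ 0 := fun h ↦ by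
    have := riemannZetaNontrivialZeros.re_pos ρ.2; rw [h] at this; simp at this
  have h1 : (ρ : ℂ) ≠ 1 := riemannZetaNontrivialZeros.ne_one ρ.2
  have hm0 : 0 ≤ (riemannZetaZeroOrder (ρ : ℂ) : ℝ) := ZetaZeroSum.zeroOrder_nonneg ρ
  rw [bracket_add_eq_bracket_mul h0 h1, norm_mul, norm_mul, norm_div, norm_mul,
    Complex.norm_intCast, abs_of_nonneg hm0]
  have hb1 := norm_one_sub_one_sub_inv_pow_le (one_le_norm_of_mem_nontrivialZeros ρ) n
  have hb2 := norm_one_sub_one_sub_inv_pow_le (one_le_norm_one_sub_of_mem_nontrivialZeros ρ) n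
  have hρ : 0 < ‖(ρ : ℂ)‖ := by linarith [one_le_norm_of_mem_nontrivialZeros ρ]
  have hρ' : 0 < ‖1 - (ρ : ℂ)‖ := by linarith [one_le_norm_one_sub_of_mem_nontrivialZeros ρ]
  calc (riemannZetaZeroOrder (ρ : ℂ) : ℝ) * (‖1 - (1 - 1 / (ρ : ℂ)) ^ n‖ *
        ‖1 - (1 - 1 / (1 - (ρ : ℂ))) ^ n‖)
      ≤ (riemannZetaZeroOrder (ρ : ℂ) : ℝ) * ((n * 2 ^ n / ‖(ρ : ℂ)‖) *
          (n * 2 ^ n / ‖1 - (ρ : ℂ)‖)) := by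
        gcongr
    _ = ((n : ℝ) * 2 ^ n) ^ 2 * ((riemannZetaZeroOrder (ρ : ℂ) : ℝ) /
          (‖(ρ : ℂ)‖ * ‖1 - (ρ : ℂ)‖)) := by
        field_simp

/-- The bracketed family: notation-free abbreviation used in the proofs below. [folklore] -/
private theorem bracket_conj (s : ℂ) (n : ℕ) :
    (1 - (1 - 1 / conj s) ^ n) + (1 - (1 - 1 / (1 - conj s)) ^ n) =
      conj ((1 - (1 - 1 / s) ^ n) + (1 - (1 - 1 / (1 - s)) ^ n)) := by
  simp only [map_add, map_sub, map_one, map_pow, map_div₀]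

/-- `1 − ρ` is again a non-trivial zero (functional equation). [folklore] -/
private theorem one_sub_mem_nontrivialZeros (ρ : riemannZetaNontrivialZeros) :
    1 - (ρ : ℂ) ∈ riemannZetaNontrivialZeros := by
  simpa using riemannZetaNontrivialZeros.one_sub_conj_mem
    (riemannZetaNontrivialZeros.conj_mem ρ.2)

/-- The involution `ρ ↦ 1 − ρ` of the non-trivial zeros is an involution. [folklore] -/
private theorem involutive_nontrivialZeros_oneSub :
    Function.Involutive (fun ρ : riemannZetaNontrivialZeros ↦
      (⟨1 - (ρ : ℂ), one_sub_mem_nontrivialZeros ρ⟩ : riemannZetaNontrivialZeros)) :=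
  fun ρ ↦ Subtype.ext (by simp)

/-- The involution `ρ ↦ ρ̄` of the non-trivial zeros is an involution. [folklore] -/
private theorem involutive_nontrivialZeros_conj :
    Function.Involutive (fun ρ : riemannZetaNontrivialZeros ↦
      (⟨conj (ρ : ℂ), riemannZetaNontrivialZeros.conj_mem ρ.2⟩ : riemannZetaNontrivialZeros)) :=
  fun ρ ↦ Subtype.ext (by simp)

/-- **[Su23b] eq. (3.9) (discharge of `Suzuki2023b_eq_s302`)**, UNCONDITIONALLY: for `n ≥ 1`,
`Σ_{ρ∈𝒵} m_ρ {[1 − (1−1/ρ)ⁿ] + [1 − (1−1/(1−ρ))ⁿ]} = 2λ_n`, the series converging absolutely.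
Proof: the family is absolutely summable (`summable_zeroOrder_mul_bracket`); its sum `S` is real,
because `ρ ↦ ρ̄` permutes the zeros with their multiplicities and conjugates the terms; and
`Re S = Σ′ m Re[1−(1−1/ρ)ⁿ] + Σ′ m Re[1−(1−1/(1−ρ))ⁿ] = λ_n + λ_n` by `keiperLiCoeff_eq_tsum_zeros`
and the reindexing `ρ ↦ 1 − ρ`. RH-FREE. [cite: Suzuki2023b, eq. (3.9), p. 8 L159–p. 9 L1] -/
theorem Suzuki2023b_eq_s302_holds : Suzuki2023b_eq_s302 := by
  intro n hn
  set F : riemannZetaNontrivialZeros → ℂ := fun ρ ↦ (riemannZetaZeroOrder (ρ : ℂ) : ℂ) *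
    ((1 - (1 - 1 / (ρ : ℂ)) ^ n) + (1 - (1 - 1 / (1 - (ρ : ℂ))) ^ n)) with hF
  have hsum : Summable F := summable_zeroOrder_mul_bracket n
  -- the real family of `keiperLiCoeff_eq_tsum_zeros`
  set f : riemannZetaNontrivialZeros → ℝ := fun ρ ↦
    (riemannZetaZeroOrder (ρ : ℂ) : ℝ) * (1 - (1 - 1 / (ρ : ℂ)) ^ n).re with hf
  have hfsum : Summable f := summable_keiperLiTerm n
  have hlam : keiperLiCoeff n = ∑' ρ, f ρ := keiperLiCoeff_eq_tsum_zeros hn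
  -- reindexing by `ρ ↦ 1 − ρ`
  set e : riemannZetaNontrivialZeros ≃ riemannZetaNontrivialZeros :=
    involutive_nontrivialZeros_oneSub.toPerm _ with he
  have hfe : ∀ ρ, f (e ρ) = (riemannZetaZeroOrder (ρ : ℂ) : ℝ) *
      (1 - (1 - 1 / (1 - (ρ : ℂ))) ^ n).re := by
    intro ρ
    have h0 := riemannZetaNontrivialZeros.re_pos ρ.2
    have h1 := riemannZetaNontrivialZeros.re_lt_one ρ.2
    simp only [hf, he, Function.Involutive.coe_toPerm]
    rw [riemannZetaZeroOrder_one_sub_holds h0 h1]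
  have hre : ∀ ρ, (F ρ).re = f ρ + f (e ρ) := by
    intro ρ
    rw [hfe]
    simp only [hF, hf, Complex.mul_re, Complex.intCast_re, Complex.intCast_im, zero_mul,
      sub_zero, Complex.add_re]
    ring
  have hRe : (∑' ρ, F ρ).re = 2 * keiperLiCoeff n := by
    have hfe' : Summable fun ρ ↦ f (e ρ) := (Equiv.summable_iff e).2 hfsum
    rw [Complex.re_tsum hsum, tsum_congr hre, hfsum.tsum_add hfe', Equiv.tsum_eq e f, ← hlam]
    ring
  -- the sum is real: conjugation symmetry
  set c : riemannZetaNontrivialZeros ≃ riemannZetaNontrivialZeros :=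
    involutive_nontrivialZeros_conj.toPerm _ with hc
  have hFc : ∀ ρ, F (c ρ) = conj (F ρ) := by
    intro ρ
    simp only [hF, hc, Function.Involutive.coe_toPerm]
    rw [riemannZetaZeroOrder_conj_holds, map_mul, map_intCast, bracket_conj]
  have hIm : (∑' ρ, F ρ).im = 0 := by
    have h1 : ∑' ρ, F ρ = conj (∑' ρ, F ρ) := by
      rw [Complex.conj_tsum, ← Equiv.tsum_eq c F]
      exact tsum_congr hFc
    exact Complex.conj_eq_iff_im.1 h1.symm
  have hval : ∑' ρ, F ρ = ((2 * keiperLiCoeff n : ℝ) : ℂ) :=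
    Complex.ext (by rw [hRe, Complex.ofReal_re]) (by rw [hIm, Complex.ofReal_im])
  rw [← hval]
  exact hsum.hasSum

/-! ## Theorem 1.1 ⟹ reduced to (3.8) -/

/-- **Reduction of [Su23b] Thm. 1.1 ⟹ to eq. (3.8)**: "equality (1.6) follows from (3.8) and
(3.9)" (p. 9 L1). Given the RH-conditional model-space identity `Suzuki2023b_eq_s301`
(`‖G_n‖² = π Σ m{[…]+[…]}` under RH), the proved (3.9) gives `λ_n = ‖G_n‖²/(2π)` under RH.
CONDITIONAL on the named statement `Suzuki2023b_eq_s301` (taken as a hypothesis; not proved in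
the tree). [cite: Suzuki2023b, §3.4, p. 8 L140–p. 9 L2] -/
theorem Suzuki2023b_thm11_onlyif_of_eq_s301 (h301 : Suzuki2023b_eq_s301) :
    Suzuki2023b_thm11_onlyif := by
  intro hRH n hn
  have h1 := h301 hRH n hn
  have h2 := Suzuki2023b_eq_s302_holds n hn
  have h12 : ((liModelGNormSq n / Real.pi : ℝ) : ℂ) = ((2 * keiperLiCoeff n : ℝ) : ℂ) :=
    h1.unique h2
  have h3 : liModelGNormSq n / Real.pi = 2 * keiperLiCoeff n := by exact_mod_cast h12
  have hπ : Real.pi ≠ 0 := Real.pi_ne_zero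
  field_simp
  field_simp at h3
  linarith

/-- **[Su23b] Thm. 1.1 (the ⟺) from eq. (3.8)**: the printed equivalence, CONDITIONAL on the
named statement `Suzuki2023b_eq_s301`; the ⟸ half is unconditional
(`Suzuki2023b_thm11_if_holds`). [cite: Suzuki2023b, Thm. 1.1, p. 2 L100–115] -/
theorem Suzuki2023b_thm11_of_eq_s301 (h301 : Suzuki2023b_eq_s301) : Suzuki2023b_thm11 :=
  ⟨Suzuki2023b_thm11_onlyif_of_eq_s301 h301, Suzuki2023b_thm11_if_holds⟩

/-! ## Eq. (1.3): the `η_k` are the tree's `liEta k` -/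

/-- The Taylor coefficients `q_k = (ζ₁′/ζ₁)^{(k)}(1)/k!` of `ζ₁′/ζ₁` at `1` are real
(`ζ₁(s̄) = conj ζ₁(s)`). [folklore] -/
private theorem im_zetaOneLogDerivCoeff (k : ℕ) : (Xiao2020.zetaOneLogDerivCoeff k).im = 0 := by
  have hg : ∀ s, logDeriv riemannZeta₁ (conj s) = conj (logDeriv riemannZeta₁ s) := by
    intro s
    have hd := iteratedDeriv_conj_of_conj riemannZeta₁_conj 1 s
    simp only [iteratedDeriv_one] at hd
    rw [logDeriv_apply, logDeriv_apply, hd, riemannZeta₁_conj, map_div₀]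
  have h := iteratedDeriv_conj_of_conj hg k 1
  rw [map_one] at h
  have him : (iteratedDeriv k (logDeriv riemannZeta₁) 1).im = 0 := Complex.conj_eq_iff_im.1 h.symm
  rw [Xiao2020.zetaOneLogDerivCoeff, Complex.div_natCast_im, him, zero_div]

/-- `(η_k : ℂ) = −q_k`: the tree's `η_k` (`liEta`, the B–L limit formula) is minus the `k`-th
Taylor coefficient of `ζ₁′/ζ₁` at `1`, as a complex number. [cite: Suzuki2023b, eq. (1.3), p. 2 L63–67] -/
theorem ofReal_liEta_eq (k : ℕ) :
    ((liEta k : ℝ) : ℂ) = -Xiao2020.zetaOneLogDerivCoeff k := by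
  rw [liEta_eq_neg_re_zetaOneLogDerivCoeff, Complex.ofReal_neg]
  congr 1
  exact Complex.ext (by simp) (by simp [im_zetaOneLogDerivCoeff])

/-- **[Su23b] eq. (1.3) (discharge of `Suzuki2023b_eq_s103`)**: there is `r > 0` such that
`−ζ′/ζ(s+1) − 1/s = Σ_{k≥0} η_k s^k` for all `0 < |s| < r`, with `η_k = liEta k`. Proof:
`−ζ′/ζ(s+1) − 1/s = −(ζ₁′/ζ₁)(1+s)` (`ζ₁(z) = (z−1)ζ(z)`, `logDeriv_riemannZeta_eq`), the Taylor
expansion of the holomorphic `ζ₁′/ζ₁` on a disc about `1` free of zeros of `ζ₁`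
(`Complex.hasSum_taylorSeries_on_ball`), and `η_k = −q_k` (`ofReal_liEta_eq`). RH-FREE.
[cite: Suzuki2023b, eq. (1.3), p. 2 L63–67] -/
theorem Suzuki2023b_eq_s103_holds : Suzuki2023b_eq_s103 := by
  -- a disc about `1` on which `ζ₁ ≠ 0`
  obtain ⟨r, hr0, hr⟩ := Metric.eventually_nhds_iff.mp riemannZeta₁_ne_zero_of_near_one
  refine ⟨r, hr0, fun s hs0 hsr ↦ ?_⟩
  set g : ℂ → ℂ := logDeriv riemannZeta₁ with hg
  have hdiff : DifferentiableOn ℂ g (Metric.ball 1 r) := by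
    intro z hz
    have hz' : riemannZeta₁ z ≠ 0 := hr (Metric.mem_ball.mp hz)
    have hζ₁ : DifferentiableAt ℂ riemannZeta₁ z := differentiable_riemannZeta₁ z
    have : DifferentiableAt ℂ g z := by
      rw [hg]
      show DifferentiableAt ℂ (fun w ↦ deriv riemannZeta₁ w / riemannZeta₁ w) z
      exact ((differentiable_riemannZeta₁.contDiff (n := 2)).differentiable_deriv_two z).div
        hζ₁ hz'
    exact this.differentiableWithinAt
  have hmem : 1 + s ∈ Metric.ball (1 : ℂ) r := by
    rw [Metric.mem_ball, dist_eq_norm, add_sub_cancel_left]; exact hsr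
  have hT := Complex.hasSum_taylorSeries_on_ball hdiff hmem
  simp only [add_sub_cancel_left] at hT
  -- identify the terms: `(k!)⁻¹ • s^k • g^{(k)}(1) = q_k s^k = -η_k s^k`
  have hterm : ∀ k : ℕ, (k.factorial : ℂ)⁻¹ • s ^ k • iteratedDeriv k g 1 =
      -(((liEta k : ℝ) : ℂ) * s ^ k) := by
    intro k
    rw [ofReal_liEta_eq, Xiao2020.zetaOneLogDerivCoeff, smul_eq_mul, smul_eq_mul]
    ring
  have hT' : HasSum (fun k : ℕ ↦ ((liEta k : ℝ) : ℂ) * s ^ k) (-g (1 + s)) := by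
    have := hT.neg
    refine this.congr_fun fun k ↦ ?_
    rw [hterm, neg_neg]
  -- identify the value: `-ζ₁'/ζ₁(1+s) = -ζ'/ζ(s+1) - 1/s`
  have hs1 : s + 1 ≠ 1 := by simpa using hs0
  have hζ : riemannZeta (s + 1) ≠ 0 := by
    have h := hr (y := 1 + s) (by rw [dist_eq_norm, add_sub_cancel_left]; exact hsr)
    rw [add_comm] at h
    exact fun h0 ↦ h ((riemannZeta₁_eq_zero_iff hs1).2 h0)
  have hval : -g (1 + s) = -(deriv riemannZeta (s + 1) / riemannZeta (s + 1)) - 1 / s := by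
    rw [hg, add_comm, ← logDeriv_apply, logDeriv_riemannZeta_eq hs1 hζ, add_sub_cancel_right,
      one_div]
    ring
  rw [← hval]
  exact hT'

/-! ## Eq. (1.7): the printed arithmetic formula, from `Coffey2005_thm1_holds` -/

/-- **[Su23b] eq. (1.7)** ("the known formula … obtained in [BoLa99, Theorem 2 and (4.1)]"):
for `n ≥ 1`, `λ_n = −Σ_{j=1}^n C(n,j)η_{j−1} + 1 − (γ₀ + log 4π)n/2
− Σ_{j=2}^n C(n,j)(−1)^{j−1}(1 − 2^{−j})ζ(j)`. This is the tree's PROVED arithmetic formula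
`Coffey2005_thm1_holds` (`λ_n = liTrend n + liOscPart n`) unfolded into the printed shape
(`log 4π = log π + 2 log 2`); no new content. RH-FREE. [cite: Suzuki2023b, eq. (1.7), p. 2 L148–159] -/
theorem Suzuki2023b_eq0301_1 {n : ℕ} (hn : 1 ≤ n) :
    keiperLiCoeff n =
      -(∑ j ∈ Icc 1 n, (n.choose j : ℝ) * liEta (j - 1)) +
        (1 - (Real.eulerMascheroniConstant + Real.log (4 * Real.pi)) * n / 2) -
        ∑ j ∈ Icc 2 n, (n.choose j : ℝ) * (-1) ^ (j - 1) * (1 - (2 : ℝ)⁻¹ ^ j) *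
          (riemannZeta j).re := by
  rw [Coffey2005_thm1_holds.2 n hn, liTrend_eq, liArchPart_eq, liOscPart_eq, liArchSum]
  have hlog : Real.log (4 * Real.pi) = Real.log Real.pi + 2 * Real.log 2 := by
    rw [Real.log_mul (by norm_num) Real.pi_ne_zero, show (4 : ℝ) = 2 ^ 2 by norm_num,
      Real.log_pow]; push_cast; ring
  rw [hlog]
  have hsum : ∑ j ∈ Icc 2 n, (n.choose j : ℝ) * (-1) ^ (j - 1) * (1 - (2 : ℝ)⁻¹ ^ j) *
      (riemannZeta j).re =
      -∑ m ∈ Icc 2 n, (-1 : ℝ) ^ m * (n.choose m : ℝ) * (1 - (2 : ℝ)⁻¹ ^ m) *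
        (riemannZeta m).re := by
    rw [← Finset.sum_neg_distrib]
    refine Finset.sum_congr rfl fun j hj ↦ ?_
    have hj2 : 2 ≤ j := (Finset.mem_Icc.1 hj).1
    obtain ⟨i, rfl⟩ : ∃ i, j = i + 1 := ⟨j - 1, by omega⟩
    rw [Nat.add_sub_cancel, pow_succ]
    ring
  rw [hsum]
  ring


/-! ## Eq. (2.9): the local behaviour of `ξ/(ξ+ξ′)` at a zero -/

/-- `ξ` is not locally zero anywhere (it is entire and `ξ(0) = 1/2`), so its order of vanishing is
finite at every point. [folklore] -/
private theorem analyticOrderAt_riemannXi_ne_top (ρ : ℂ) : analyticOrderAt riemannXi ρ ≠ ⊤ := by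
  intro htop
  have h0 : ∀ᶠ z in 𝓝 ρ, riemannXi z = 0 := analyticOrderAt_eq_top.mp htop
  have hall : AnalyticOnNhd ℂ riemannXi Set.univ := fun z _ ↦ differentiable_riemannXi.analyticAt z
  have := hall.eqOn_zero_of_preconnected_of_eventuallyEq_zero isPreconnected_univ (Set.mem_univ ρ)
    h0 (Set.mem_univ 0)
  rw [Pi.zero_apply, riemannXi_zero] at this
  norm_num at this

/-- The order of vanishing of `ξ` at a non-trivial zero is the tree's multiplicity
`m(ρ) = riemannZetaZeroOrder ρ` (module dictionary: "`m_ρ` counts the multiplicity of the zero of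
`ξ(s)` at `s = ρ`", p. 4 L7–8; `untop₀_meromorphicOrderAt_riemannXi`).
[cite: Suzuki2023b, §2.1, p. 4 L5–8] -/
theorem natCast_analyticOrderNatAt_riemannXi {ρ : ℂ} (hρ : ρ ∈ riemannZetaNontrivialZeros) :
    ((analyticOrderNatAt riemannXi ρ : ℕ) : ℤ) = riemannZetaZeroOrder ρ := by
  rw [← untop₀_meromorphicOrderAt_riemannXi (riemannZetaNontrivialZeros.re_pos hρ)
    (riemannZetaNontrivialZeros.ne_one hρ),
    (differentiable_riemannXi.analyticAt ρ).meromorphicOrderAt_eq,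
    ← Nat.cast_analyticOrderNatAt (analyticOrderAt_riemannXi_ne_top ρ)]
  simp

/-- **[Su23b] eq. (2.9) (discharge of `Suzuki2023b_eq_s212`)**: at a zero `ρ` of multiplicity
`m_ρ`, `ξ(s)/((ξ(s)+ξ′(s))(s−ρ)) → 1/m_ρ` as `s → ρ` — from the factorisation
`ξ(s) = (s−ρ)^{m} g(s)`, `g(ρ) ≠ 0` ("the series expansion `ξ(s) = c(m_ρ)(s−ρ)^{m_ρ}(1+o(1))`"),
whence `ξ/((ξ+ξ′)(s−ρ)) = g/(m g + (s−ρ)(g+g′))`. RH-FREE. [cite: Suzuki2023b, eq. (2.9), p. 6 L26–36] -/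
theorem Suzuki2023b_eq_s212_holds : Suzuki2023b_eq_s212 := by
  intro ρ hρ
  have hξa : AnalyticAt ℂ riemannXi ρ := differentiable_riemannXi.analyticAt ρ
  obtain ⟨m, hmdef⟩ : ∃ m : ℕ, analyticOrderNatAt riemannXi ρ = m := ⟨_, rfl⟩
  have hmZ : ((m : ℕ) : ℤ) = riemannZetaZeroOrder ρ := by
    rw [← hmdef]; exact natCast_analyticOrderNatAt_riemannXi hρ
  have hm1 : 1 ≤ m := by
    have := riemannZetaNontrivialZeros.one_le_order hρ
    omega
  obtain ⟨g, hg, hg0, hfg⟩ :=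
    (hξa.analyticOrderNatAt_eq_iff (analyticOrderAt_riemannXi_ne_top ρ)).mp hmdef
  obtain ⟨k, rfl⟩ : ∃ k, m = k + 1 := ⟨m - 1, by omega⟩
  -- the derivative of `ξ` near `ρ`
  have hfg' : riemannXi =ᶠ[𝓝 ρ] fun z ↦ (z - ρ) ^ (k + 1) * g z :=
    hfg.mono fun z hz ↦ by rw [hz, smul_eq_mul]
  have hderiv : ∀ᶠ z in 𝓝 ρ, deriv riemannXi z =
      (k + 1) * (z - ρ) ^ k * g z + (z - ρ) ^ (k + 1) * deriv g z := by
    filter_upwards [hfg'.deriv, hg.eventually_analyticAt] with z hz hgz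
    have hd1 : HasDerivAt (fun w : ℂ ↦ (w - ρ) ^ (k + 1)) ((k + 1) * (z - ρ) ^ k) z := by
      have h := (hasDerivAt_pow (k + 1) (z - ρ)).comp z ((hasDerivAt_id z).sub_const ρ)
      simpa [Function.comp_def] using h
    rw [hz, deriv_fun_mul hd1.differentiableAt hgz.differentiableAt, hd1.deriv]
  -- the function agrees, on a punctured neighbourhood, with a function continuous at `ρ`
  have hEq : (fun s ↦ g s / ((k + 1) * g s + (s - ρ) * (g s + deriv g s))) =ᶠ[𝓝[≠] ρ]
      fun s ↦ riemannXi s / ((riemannXi s + deriv riemannXi s) * (s - ρ)) := by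
    filter_upwards [hfg'.filter_mono nhdsWithin_le_nhds, hderiv.filter_mono nhdsWithin_le_nhds,
      self_mem_nhdsWithin] with z hz hdz hne
    rw [hz, hdz]
    have hzρ : (z - ρ) ^ (k + 1) ≠ 0 := pow_ne_zero _ (sub_ne_zero.2 hne)
    have : ((z - ρ) ^ (k + 1) * g z + ((k + 1) * (z - ρ) ^ k * g z +
        (z - ρ) ^ (k + 1) * deriv g z)) * (z - ρ) =
        (z - ρ) ^ (k + 1) * ((k + 1) * g z + (z - ρ) * (g z + deriv g z)) := by ring
    rw [this, mul_div_mul_left _ _ hzρ]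
  have hk1 : ((k : ℂ) + 1) ≠ 0 := by exact_mod_cast Nat.succ_ne_zero k
  have hcont : ContinuousAt (fun s ↦ g s / ((k + 1) * g s + (s - ρ) * (g s + deriv g s))) ρ := by
    have hgc : ContinuousAt g ρ := hg.continuousAt
    have hg'c : ContinuousAt (deriv g) ρ := hg.deriv.continuousAt
    refine hgc.div₀ ((continuousAt_const.mul hgc).add
      ((continuousAt_id.sub continuousAt_const).mul (hgc.add hg'c))) ?_
    simp only [sub_self, zero_mul, add_zero]
    exact mul_ne_zero hk1 hg0
  have hlim := hcont.tendsto
  simp only [sub_self, zero_mul, add_zero] at hlim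
  have hval : g ρ / ((k + 1 : ℂ) * g ρ) = 1 / (riemannZetaZeroOrder ρ : ℂ) := by
    rw [← hmZ]; push_cast; field_simp
  rw [← hval]
  exact (hlim.mono_left nhdsWithin_le_nhds).congr' hEq

/-! ## Lemma 2.1: `M_n` is meromorphic with at most simple poles at the zeros -/

/-- The non-trivial zeros do not accumulate: every point has a punctured neighbourhood free of
them (finitely many zeros in every disc, `riemannZetaNontrivialZeros_finite_inter_ball`), in the
quantitative form "some `δ ∈ (0, 1/2]` with `|ρ − s| ≥ 2δ` for every zero `ρ ≠ s`". [folklore] -/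
private theorem exists_pos_le_norm_sub_of_nontrivialZeros (s : ℂ) :
    ∃ δ : ℝ, 0 < δ ∧ δ ≤ 1 / 2 ∧
      ∀ ρ ∈ riemannZetaNontrivialZeros, ρ ≠ s → 2 * δ ≤ ‖ρ - s‖ := by
  set A := (riemannZetaNontrivialZeros ∩ Metric.ball s 1) \ {s} with hA
  have hfin : A.Finite := (riemannZetaNontrivialZeros_finite_inter_ball s 1).subset Set.sdiff_subset
  have hs : s ∈ Aᶜ := fun h ↦ h.2 rfl
  obtain ⟨ε, hε, hball⟩ := Metric.isOpen_iff.mp hfin.isClosed.isOpen_compl s hs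
  refine ⟨min ε 1 / 2, by positivity, by
    have := min_le_right ε 1; linarith, fun ρ hρ hne ↦ ?_⟩
  by_contra hlt
  rw [not_le] at hlt
  have h1 : ρ ∈ Metric.ball s 1 := by
    rw [Metric.mem_ball, dist_eq_norm]; linarith [min_le_right ε 1]
  have h2 : ρ ∈ Metric.ball s ε := by
    rw [Metric.mem_ball, dist_eq_norm]; linarith [min_le_left ε 1]
  exact hball h2 ⟨⟨hρ, h1⟩, hne⟩

/-- **Uniform domination of the terms of `M_n` on a small disc** (the printed "converges absolutely
and uniformly on every compact subset of `ℂ ∖ 𝒵`", made effective): if every zero `ρ ≠ s₀` has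
`|ρ − s₀| ≥ 2δ` (`0 < δ ≤ 1/2`), then for `|w − s₀| < δ` and every zero `ρ ≠ s₀`,
`‖m_ρ[1−(1−1/ρ)ⁿ]/(w−ρ)‖ ≤ K · m_ρ/(|ρ|·|1−ρ|)` with `K = 2(1 + |1−s₀|/(2δ)) n 2ⁿ` — a summable
majorant (`summable_norm_zeroOrder_div_mul_one_sub`). [cite: Suzuki2023b, Lemma 2.1 (proof), p. 4 L30–36] -/
theorem norm_liModelM_term_le {s₀ : ℂ} {δ : ℝ} (hδ : 0 < δ) (hδ2 : δ ≤ 1 / 2)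
    (hsep : ∀ ρ ∈ riemannZetaNontrivialZeros, ρ ≠ s₀ → 2 * δ ≤ ‖ρ - s₀‖) (n : ℕ)
    (ρ : riemannZetaNontrivialZeros) (hρ : (ρ : ℂ) ≠ s₀) {w : ℂ} (hw : ‖w - s₀‖ < δ) :
    ‖(riemannZetaZeroOrder (ρ : ℂ) : ℂ) * (1 - (1 - 1 / (ρ : ℂ)) ^ n) / (w - ρ)‖ ≤
      (2 * (1 + ‖1 - s₀‖ / (2 * δ)) * (n * 2 ^ n)) *
        ‖(riemannZetaZeroOrder (ρ : ℂ) : ℂ) / ((ρ : ℂ) * (1 - ρ))‖ := by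
  have hm0 : 0 ≤ (riemannZetaZeroOrder (ρ : ℂ) : ℝ) := ZetaZeroSum.zeroOrder_nonneg ρ
  have hρs := hsep ρ ρ.2 hρ
  have hρ1 := one_le_norm_of_mem_nontrivialZeros ρ
  have hρ1' := one_le_norm_one_sub_of_mem_nontrivialZeros ρ
  have hb := norm_one_sub_one_sub_inv_pow_le hρ1 n
  -- `|w − ρ| ≥ |ρ − s₀|/2`
  have hwρ : ‖(ρ : ℂ) - s₀‖ / 2 ≤ ‖w - ρ‖ := by
    have := norm_sub_le_norm_sub_add_norm_sub (ρ : ℂ) w s₀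
    have h' : ‖(ρ : ℂ) - w‖ = ‖w - ρ‖ := norm_sub_rev _ _
    linarith
  have hwρ0 : 0 < ‖w - (ρ : ℂ)‖ := by linarith
  -- `|1 − ρ| ≤ (1 + |1 − s₀|/(2δ)) |ρ − s₀|`
  have h1ρ : ‖1 - (ρ : ℂ)‖ ≤ (1 + ‖1 - s₀‖ / (2 * δ)) * ‖(ρ : ℂ) - s₀‖ := by
    have htri : ‖1 - (ρ : ℂ)‖ ≤ ‖1 - s₀‖ + ‖(ρ : ℂ) - s₀‖ := by
      have := norm_sub_le_norm_sub_add_norm_sub (1 : ℂ) s₀ ρ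
      rwa [norm_sub_rev s₀] at this
    have hge : ‖1 - s₀‖ ≤ ‖1 - s₀‖ / (2 * δ) * ‖(ρ : ℂ) - s₀‖ := by
      rw [div_mul_eq_mul_div, le_div_iff₀ (by positivity)]
      exact mul_le_mul_of_nonneg_left hρs (norm_nonneg _)
    linarith
  rw [norm_div, norm_mul, Complex.norm_intCast, abs_of_nonneg hm0, norm_div, norm_mul,
    Complex.norm_intCast, abs_of_nonneg hm0]
  have hρpos : 0 < ‖(ρ : ℂ)‖ := by linarith
  have hρ'pos : 0 < ‖1 - (ρ : ℂ)‖ := by linarith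
  -- assemble
  calc (riemannZetaZeroOrder (ρ : ℂ) : ℝ) * ‖1 - (1 - 1 / (ρ : ℂ)) ^ n‖ / ‖w - ρ‖
      ≤ (riemannZetaZeroOrder (ρ : ℂ) : ℝ) * (n * 2 ^ n / ‖(ρ : ℂ)‖) / (‖(ρ : ℂ) - s₀‖ / 2) := by
        have h2 : 0 < ‖(ρ : ℂ) - s₀‖ / 2 := by linarith
        gcongr
    _ = (2 * (n * 2 ^ n)) *
          ((riemannZetaZeroOrder (ρ : ℂ) : ℝ) / (‖(ρ : ℂ)‖ * ‖(ρ : ℂ) - s₀‖)) := by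
        field_simp
    _ ≤ (2 * (n * 2 ^ n)) * ((1 + ‖1 - s₀‖ / (2 * δ)) *
          ((riemannZetaZeroOrder (ρ : ℂ) : ℝ) / (‖(ρ : ℂ)‖ * ‖1 - (ρ : ℂ)‖))) := by
        gcongr 2 * (n * 2 ^ n) * ?_
        rw [← mul_div_assoc, div_le_div_iff₀ (mul_pos hρpos (by linarith)) (mul_pos hρpos hρ'pos)]
        calc (riemannZetaZeroOrder (ρ : ℂ) : ℝ) * (‖(ρ : ℂ)‖ * ‖1 - (ρ : ℂ)‖)
            ≤ (riemannZetaZeroOrder (ρ : ℂ) : ℝ) * (‖(ρ : ℂ)‖ *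
                ((1 + ‖1 - s₀‖ / (2 * δ)) * ‖(ρ : ℂ) - s₀‖)) := by gcongr
          _ = (1 + ‖1 - s₀‖ / (2 * δ)) * (riemannZetaZeroOrder (ρ : ℂ) : ℝ) *
                (‖(ρ : ℂ)‖ * ‖(ρ : ℂ) - s₀‖) := by ring
    _ = (2 * (1 + ‖1 - s₀‖ / (2 * δ)) * (n * 2 ^ n)) *
          ((riemannZetaZeroOrder (ρ : ℂ) : ℝ) / (‖(ρ : ℂ)‖ * ‖1 - (ρ : ℂ)‖)) := by ring

/-- **The sum of the `ρ ≠ s₀` terms of `M_n` is holomorphic near `s₀`** (any `s₀ ∈ ℂ`): on a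
disc `|w − s₀| < δ` as above, `w ↦ Σ'_{ρ ≠ s₀} m_ρ[1−(1−1/ρ)ⁿ]/(w−ρ)` is differentiable, by
uniform domination (`Complex.differentiableOn_tsum_of_summable_norm`). For `s₀ ∉ 𝒵` this is the
whole series. [cite: Suzuki2023b, Lemma 2.1 (proof), p. 4 L30–38] -/
theorem differentiableOn_tsum_liModelM_terms_ne {s₀ : ℂ} {δ : ℝ} (hδ : 0 < δ) (hδ2 : δ ≤ 1 / 2)
    (hsep : ∀ ρ ∈ riemannZetaNontrivialZeros, ρ ≠ s₀ → 2 * δ ≤ ‖ρ - s₀‖) (n : ℕ) :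
    DifferentiableOn ℂ (fun w ↦ ∑' ρ : riemannZetaNontrivialZeros,
      if (ρ : ℂ) = s₀ then 0 else
        (riemannZetaZeroOrder (ρ : ℂ) : ℂ) * (1 - (1 - 1 / (ρ : ℂ)) ^ n) / (w - ρ))
      (Metric.ball s₀ δ) := by
  set K : ℝ := 2 * (1 + ‖1 - s₀‖ / (2 * δ)) * (n * 2 ^ n) with hK
  have hu := (summable_norm_zeroOrder_div_mul_one_sub).mul_left K
  refine Complex.differentiableOn_tsum_of_summable_norm hu (fun ρ ↦ ?_) Metric.isOpen_ball
    (fun ρ w hw ↦ ?_)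
  · by_cases hρ : (ρ : ℂ) = s₀
    · simp only [hρ, if_true]; exact differentiableOn_const 0
    · simp only [hρ, if_false]
      refine DifferentiableOn.div (differentiableOn_const _)
        (differentiableOn_id.sub (differentiableOn_const _)) fun w hw ↦ ?_
      rw [Metric.mem_ball, dist_eq_norm] at hw
      intro h0
      have hw' : w = ρ := sub_eq_zero.1 h0
      have := hsep ρ ρ.2 hρ
      rw [hw'] at hw
      linarith
  · by_cases hρ : (ρ : ℂ) = s₀
    · simp only [hρ, if_true, norm_zero]
      exact mul_nonneg (by positivity) (norm_nonneg _)
    · simp only [hρ, if_false]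
      rw [Metric.mem_ball, dist_eq_norm] at hw
      exact norm_liModelM_term_le hδ hδ2 hsep n ρ hρ hw

/-- At a point `s ∉ 𝒵` the series (2.1) converges absolutely. [cite: Suzuki2023b, Lemma 2.1, p. 4 L30–36] -/
theorem summable_liModelM_terms {s : ℂ} (hs : s ∉ riemannZetaNontrivialZeros) (n : ℕ) :
    Summable fun ρ : riemannZetaNontrivialZeros ↦
      (riemannZetaZeroOrder (ρ : ℂ) : ℂ) * (1 - (1 - 1 / (ρ : ℂ)) ^ n) / (s - ρ) := by
  obtain ⟨δ, hδ, hδ2, hsep⟩ := exists_pos_le_norm_sub_of_nontrivialZeros s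
  have hu := (summable_norm_zeroOrder_div_mul_one_sub).mul_left
    (2 * (1 + ‖1 - s‖ / (2 * δ)) * (n * 2 ^ n))
  refine Summable.of_norm_bounded hu fun ρ ↦ ?_
  have hρ : (ρ : ℂ) ≠ s := fun h ↦ hs (h ▸ ρ.2)
  exact norm_liModelM_term_le hδ hδ2 hsep n ρ hρ (by simp [hδ])

/-- Off `𝒵`, `M_n(w)` splits as the `ρ₀`-term plus the holomorphic remainder
`Σ'_{ρ ≠ ρ₀}` (for any `ρ₀ ∈ 𝒵`). [cite: Suzuki2023b, Lemma 2.1, p. 4 L16–38] -/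
theorem tsum_liModelM_terms_eq_add {w : ℂ} (hw : w ∉ riemannZetaNontrivialZeros) (n : ℕ)
    (ρ₀ : riemannZetaNontrivialZeros) :
    ∑' ρ : riemannZetaNontrivialZeros,
        (riemannZetaZeroOrder (ρ : ℂ) : ℂ) * (1 - (1 - 1 / (ρ : ℂ)) ^ n) / (w - ρ) =
      (riemannZetaZeroOrder (ρ₀ : ℂ) : ℂ) * (1 - (1 - 1 / (ρ₀ : ℂ)) ^ n) / (w - ρ₀) +
      ∑' ρ : riemannZetaNontrivialZeros,
        if (ρ : ℂ) = ρ₀ then 0 else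
          (riemannZetaZeroOrder (ρ : ℂ) : ℂ) * (1 - (1 - 1 / (ρ : ℂ)) ^ n) / (w - ρ) := by
  classical
  rw [(summable_liModelM_terms hw n).tsum_eq_add_tsum_ite ρ₀]
  congr 1
  refine tsum_congr fun ρ ↦ ?_
  by_cases h : ρ = ρ₀
  · simp [h]
  · have h' : (ρ : ℂ) ≠ ρ₀ := fun e ↦ h (Subtype.ext e)
    simp [h, h']

/-- **[Su23b] Lemma 2.1 (discharge of `Suzuki2023b_lemma21`)**: for `n ≥ 1`, the series (2.1)
converges absolutely off `𝒵`, `M_n` is holomorphic on `ℂ ∖ 𝒵`, and at each `ρ ∈ 𝒵`,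
`(s−ρ)M_n(s) → −i m_ρ[1−(1−1/ρ)ⁿ]` (at most a simple pole, with this residue). Printed proof:
absolute and locally uniform convergence from `Σ m_ρ|ρ|^{−1−δ} < ∞`; here from
`Σ m_ρ/|ρ(1−ρ)| < ∞` and the separation of the zeros. RH-FREE.
[cite: Suzuki2023b, Lemma 2.1, p. 4 L16–38] -/
theorem Suzuki2023b_lemma21_holds : Suzuki2023b_lemma21 := by
  intro n hn
  refine ⟨fun s hs ↦ summable_liModelM_terms hs n, fun s hs ↦ ?_, fun ρ₀ hρ₀ ↦ ?_⟩
  · -- (ii) holomorphy at `s ∉ 𝒵`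
    obtain ⟨δ, hδ, hδ2, hsep⟩ := exists_pos_le_norm_sub_of_nontrivialZeros s
    have hdiff := differentiableOn_tsum_liModelM_terms_ne hδ hδ2 hsep n
    -- on the disc the `ite` never fires off `𝒵`... but it may fire at zeros inside the disc other
    -- than `s`: there are none within `2δ` except possibly `s` itself, and `s ∉ 𝒵`.
    have hne : ∀ ρ : riemannZetaNontrivialZeros, (ρ : ℂ) ≠ s := fun ρ h ↦ hs (h ▸ ρ.2)
    have heq : (fun w ↦ ∑' ρ : riemannZetaNontrivialZeros,
        if (ρ : ℂ) = s then 0 else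
          (riemannZetaZeroOrder (ρ : ℂ) : ℂ) * (1 - (1 - 1 / (ρ : ℂ)) ^ n) / (w - ρ)) =
        fun w ↦ ∑' ρ : riemannZetaNontrivialZeros,
          (riemannZetaZeroOrder (ρ : ℂ) : ℂ) * (1 - (1 - 1 / (ρ : ℂ)) ^ n) / (w - ρ) := by
      funext w
      exact tsum_congr fun ρ ↦ by simp [hne ρ]
    rw [heq] at hdiff
    have hat := hdiff.differentiableAt (Metric.ball_mem_nhds s hδ)
    have hM : liModelM n = fun w ↦ -I * ∑' ρ : riemannZetaNontrivialZeros,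
        (riemannZetaZeroOrder (ρ : ℂ) : ℂ) * (1 - (1 - 1 / (ρ : ℂ)) ^ n) / (w - ρ) := by
      funext w; rfl
    rw [hM]
    exact ((differentiableAt_const _).mul hat).differentiableWithinAt
  · -- (iii) the residue at `ρ₀ ∈ 𝒵`
    obtain ⟨δ, hδ, hδ2, hsep⟩ := exists_pos_le_norm_sub_of_nontrivialZeros ρ₀
    set R : ℂ → ℂ := fun w ↦ ∑' ρ : riemannZetaNontrivialZeros,
      if (ρ : ℂ) = ρ₀ then 0 else
        (riemannZetaZeroOrder (ρ : ℂ) : ℂ) * (1 - (1 - 1 / (ρ : ℂ)) ^ n) / (w - ρ) with hR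
    have hdiff : DifferentiableOn ℂ R (Metric.ball ρ₀ δ) :=
      differentiableOn_tsum_liModelM_terms_ne hδ hδ2 hsep n
    have hRc : ContinuousAt R ρ₀ :=
      (hdiff.differentiableAt (Metric.ball_mem_nhds ρ₀ hδ)).continuousAt
    have hpunct : ∀ᶠ w in 𝓝[≠] ρ₀, w ∉ riemannZetaNontrivialZeros := by
      have hball : ∀ᶠ w in 𝓝[≠] ρ₀, ‖w - ρ₀‖ < δ ∧ w ≠ ρ₀ := by
        filter_upwards [mem_nhdsWithin_of_mem_nhds (Metric.ball_mem_nhds ρ₀ hδ),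
          self_mem_nhdsWithin] with w hw hne
        exact ⟨by rwa [Metric.mem_ball, dist_eq_norm] at hw, hne⟩
      filter_upwards [hball] with w ⟨hw, hne⟩ hwZ
      have := hsep w hwZ hne
      linarith
    have hEq : (fun w ↦ -I * ((riemannZetaZeroOrder ρ₀ : ℂ) * (1 - (1 - 1 / ρ₀) ^ n) +
        (w - ρ₀) * R w)) =ᶠ[𝓝[≠] ρ₀] fun w ↦ (w - ρ₀) * liModelM n w := by
      filter_upwards [hpunct, self_mem_nhdsWithin] with w hw hne
      have hM : liModelM n w = -I * ∑' ρ : riemannZetaNontrivialZeros,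
          (riemannZetaZeroOrder (ρ : ℂ) : ℂ) * (1 - (1 - 1 / (ρ : ℂ)) ^ n) / (w - ρ) := rfl
      rw [hM, tsum_liModelM_terms_eq_add hw n ⟨ρ₀, hρ₀⟩]
      have hRw : R w = ∑' ρ : riemannZetaNontrivialZeros,
          if (ρ : ℂ) = ρ₀ then 0 else
            (riemannZetaZeroOrder (ρ : ℂ) : ℂ) * (1 - (1 - 1 / (ρ : ℂ)) ^ n) / (w - ρ) := rfl
      rw [← hRw]
      have hwρ : w - ρ₀ ≠ 0 := sub_ne_zero.2 hne
      field_simp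
    have hlim : Tendsto (fun w ↦ -I * ((riemannZetaZeroOrder ρ₀ : ℂ) * (1 - (1 - 1 / ρ₀) ^ n) +
        (w - ρ₀) * R w)) (𝓝 ρ₀)
        (𝓝 (-I * ((riemannZetaZeroOrder ρ₀ : ℂ) * (1 - (1 - 1 / ρ₀) ^ n) + 0))) := by
      have h1 : Tendsto (fun w ↦ (w - ρ₀) * R w) (𝓝 ρ₀) (𝓝 0) := by
        have hc : ContinuousAt (fun w : ℂ ↦ (w - ρ₀) * R w) ρ₀ :=
          ((continuousAt_id.sub (continuousAt_const (y := ρ₀))).mul hRc)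
        simpa using hc.tendsto
      exact tendsto_const_nhds.mul (tendsto_const_nhds.add h1)
    rw [add_zero, ← mul_assoc] at hlim
    exact (hlim.mono_left nhdsWithin_le_nhds).congr' hEq

/-! ## Proposition 2.1: `H_n = iξ/(ξ+ξ′) · M_n`

The printed proof applies Weil's explicit formula to a truncation of `g_n ∗ (−ix^{−s}𝟙_{(1,∞)})`.
We follow the tree instead ("a genuinely shorter road"): Hadamard's partial fractions
`ξ′/ξ(s) − ξ′/ξ(0) = Σ_ρ m_ρ[1/(s−ρ) + 1/ρ]` (from `RiemannXiHadamardProduct.lean` with the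
multiplicity bookkeeping of `EquivalentsKeiperLiProofs.lean`), the power sums
`Σ_ρ m_ρ ρ^{−(k+1)} = 1 − [(−1)^k η_k + (1 − 2^{−k−1})ζ(k+1)]` (`k ≥ 1`; from
`(ξ′/ξ)^{(k)}(1)` termwise, `hasSum_iteratedDeriv_term_one`, and the Taylor coefficients of
`log ξ` at `1`, `Xiao2020.logXiTaylorCoeff_succ`), and finite algebra. -/

/-- For `|ρ − s| ≥ 2δ`: `|1 − ρ| ≤ (1 + |1 − s|/(2δ))·|ρ − s|`. [folklore] -/
private theorem norm_one_sub_le_of_sep {s ρ : ℂ} {δ : ℝ} (hδ : 0 < δ) (hρs : 2 * δ ≤ ‖ρ - s‖) :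
    ‖1 - ρ‖ ≤ (1 + ‖1 - s‖ / (2 * δ)) * ‖ρ - s‖ := by
  have htri : ‖1 - ρ‖ ≤ ‖1 - s‖ + ‖ρ - s‖ := by
    have := norm_sub_le_norm_sub_add_norm_sub (1 : ℂ) s ρ
    rwa [norm_sub_rev s] at this
  have hge : ‖1 - s‖ ≤ ‖1 - s‖ / (2 * δ) * ‖ρ - s‖ := by
    rw [div_mul_eq_mul_div, le_div_iff₀ (by positivity)]
    exact mul_le_mul_of_nonneg_left hρs (norm_nonneg _)
  linarith

/-- A zero of `ξ` is a non-trivial zero of `ζ` (`riemannXi_eq_zero_iff_holds`): `ξ(s) ≠ 0` off `𝒵`,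
and conversely. [cite: Suzuki2023b, §2.1, p. 4 L5–13] -/
theorem riemannXi_ne_zero_iff_not_mem (s : ℂ) :
    riemannXi s ≠ 0 ↔ s ∉ riemannZetaNontrivialZeros := by
  rw [not_iff_not]
  rw [riemannXi_eq_zero_iff_holds s, riemannZetaNontrivialZeros.mem_iff']

/-- **Hadamard's partial fractions for `ξ′/ξ` over the zeros with multiplicity**
(Titchmarsh §2.12, (2.12.7): `ξ′/ξ(s) = B + Σ_ρ [1/(s−ρ) + 1/ρ]`, `B = ξ′/ξ(0)`): at every `s` with
`ξ(s) ≠ 0`, `Σ_{ρ∈𝒵} m_ρ [1/(s−ρ) + 1/ρ] = ξ′/ξ(s) − ξ′/ξ(0)`, the series converging absolutely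
(`|1/(s−ρ) + 1/ρ| = |s|/(|ρ||s−ρ|)`). From the tree's Hadamard pair series
`IsHadamardSeq.logDeriv_riemannXi_eq_tsum_pairs` at `s` and at `0`, and the multiplicity
bookkeeping `IsHadamardSeq.finsum_liZeroBox_eq_sum` / `tendsto_sum_truncation`.
[cite: Titchmarsh1986, §2.12, eq. (2.12.7)] -/
theorem hasSum_zeroOrder_mul_inv_sub_add_inv {s : ℂ} (hξ : riemannXi s ≠ 0) :
    HasSum (fun ρ : riemannZetaNontrivialZeros ↦
      (riemannZetaZeroOrder (ρ : ℂ) : ℂ) * (1 / (s - ρ) + 1 / ρ))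
      (logDeriv riemannXi s - logDeriv riemannXi 0) := by
  classical
  obtain ⟨b, hb⟩ := exists_isHadamardSeq 0
  have hξ0 : riemannXi 0 ≠ 0 := by rw [riemannXi_zero]; norm_num
  set F : ℂ → ℂ := fun ρ ↦ 1 / (s - ρ) + 1 / ρ with hF
  set G : ℕ → ℂ := fun k ↦ if b k = 0 then 0 else
      (F (IsHadamardSeq.xiZero b k) + F (1 - IsHadamardSeq.xiZero b k)) with hG
  have hGsum : HasSum G (logDeriv riemannXi s - logDeriv riemannXi 0) := by
    have h1 := (hb.summable_pairs hξ).hasSum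
    have h2 := (hb.summable_pairs hξ0).hasSum
    rw [← hb.logDeriv_riemannXi_eq_tsum_pairs hξ] at h1
    rw [← hb.logDeriv_riemannXi_eq_tsum_pairs hξ0] at h2
    refine (h1.sub h2).congr_fun fun k ↦ ?_
    simp only [hG, hF]
    split_ifs with hk
    · simp
    · simp only [zero_sub, div_neg]
      ring
  have hG0 : ∀ k, b k = 0 → G k = 0 := fun k hk ↦ by simp [hG, hk]
  set K : ℝ → Finset ℕ := fun T ↦ (hb.finite_setOf_abs_im_xiZero_le T).toFinset with hK
  have hKmem : ∀ T k, k ∈ K T ↔ b k ≠ 0 ∧ |(IsHadamardSeq.xiZero b k).im| ≤ T := fun T k ↦ by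
    rw [hK, Set.Finite.mem_toFinset]; rfl
  have hlim1 : Tendsto (fun T ↦ ∑ k ∈ K T, G k) atTop
      (𝓝 (logDeriv riemannXi s - logDeriv riemannXi 0)) :=
    IsHadamardSeq.tendsto_sum_truncation hGsum hG0 K hKmem
  have hbox : ∀ T, ∑ ρ ∈ weilZeroFinset T, (riemannZetaZeroOrder (ρ : ℂ) : ℂ) * F ρ =
      ∑ k ∈ K T, G k := by
    intro T
    rw [← ZetaZeroSum.finsum_mem_weilZeroIndex_eq_sum (fun ρ ↦ (riemannZetaZeroOrder ρ : ℂ) * F ρ) T,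
      ← liZeroBox_eq_weilZeroIndex, hb.finsum_liZeroBox_eq_sum F T (K T) (hKmem T)]
    refine Finset.sum_congr rfl fun k hk ↦ ?_
    simp [hG, ((hKmem T k).1 hk).1]
  -- absolute convergence over the subtype
  have hs : s ∉ riemannZetaNontrivialZeros := (riemannXi_ne_zero_iff_not_mem s).1 hξ
  obtain ⟨δ, hδ, hδ2, hsep⟩ := exists_pos_le_norm_sub_of_nontrivialZeros s
  have hsumC : Summable fun ρ : riemannZetaNontrivialZeros ↦
      (riemannZetaZeroOrder (ρ : ℂ) : ℂ) * F ρ := by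
    have hu := (summable_norm_zeroOrder_div_mul_one_sub).mul_left
      (‖s‖ * (1 + ‖1 - s‖ / (2 * δ)))
    refine Summable.of_norm_bounded hu fun ρ ↦ ?_
    have hρs : (ρ : ℂ) ≠ s := fun h ↦ hs (h ▸ ρ.2)
    have h0 : (ρ : ℂ) ≠ 0 := fun h ↦ by
      have := riemannZetaNontrivialZeros.re_pos ρ.2; rw [h] at this; simp at this
    have hsρ : s - ρ ≠ 0 := sub_ne_zero.2 (Ne.symm hρs)
    have hm0 : 0 ≤ (riemannZetaZeroOrder (ρ : ℂ) : ℝ) := ZetaZeroSum.zeroOrder_nonneg ρ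
    have hsep' := hsep ρ ρ.2 hρs
    have h1ρ := norm_one_sub_le_of_sep hδ hsep'
    have hρ1 := one_le_norm_of_mem_nontrivialZeros ρ
    have hρ1' := one_le_norm_one_sub_of_mem_nontrivialZeros ρ
    have hF' : F ρ = s / ((ρ : ℂ) * (s - ρ)) := by
      simp only [hF]; field_simp; ring
    rw [hF', norm_mul, norm_div, norm_mul, Complex.norm_intCast, abs_of_nonneg hm0, norm_div,
      norm_mul, Complex.norm_intCast, abs_of_nonneg hm0]
    have hρspos : 0 < ‖(ρ : ℂ) - s‖ := by linarith
    have hsρn : ‖s - (ρ : ℂ)‖ = ‖(ρ : ℂ) - s‖ := norm_sub_rev _ _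
    rw [hsρn]
    have hρpos : 0 < ‖(ρ : ℂ)‖ := by linarith
    have hρ'pos : 0 < ‖1 - (ρ : ℂ)‖ := by linarith
    have key : ‖s‖ / (‖(ρ : ℂ)‖ * ‖(ρ : ℂ) - s‖) ≤
        ‖s‖ * (1 + ‖1 - s‖ / (2 * δ)) / (‖(ρ : ℂ)‖ * ‖1 - (ρ : ℂ)‖) := by
      rw [div_le_div_iff₀ (mul_pos hρpos hρspos) (mul_pos hρpos hρ'pos)]
      calc ‖s‖ * (‖(ρ : ℂ)‖ * ‖1 - (ρ : ℂ)‖)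
          ≤ ‖s‖ * (‖(ρ : ℂ)‖ * ((1 + ‖1 - s‖ / (2 * δ)) * ‖(ρ : ℂ) - s‖)) := by gcongr
        _ = ‖s‖ * (1 + ‖1 - s‖ / (2 * δ)) * (‖(ρ : ℂ)‖ * ‖(ρ : ℂ) - s‖) := by ring
    calc (riemannZetaZeroOrder (ρ : ℂ) : ℝ) * (‖s‖ / (‖(ρ : ℂ)‖ * ‖(ρ : ℂ) - s‖))
        ≤ (riemannZetaZeroOrder (ρ : ℂ) : ℝ) *
            (‖s‖ * (1 + ‖1 - s‖ / (2 * δ)) / (‖(ρ : ℂ)‖ * ‖1 - (ρ : ℂ)‖)) := by gcongr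
      _ = ‖s‖ * (1 + ‖1 - s‖ / (2 * δ)) *
            ((riemannZetaZeroOrder (ρ : ℂ) : ℝ) / (‖(ρ : ℂ)‖ * ‖1 - (ρ : ℂ)‖)) := by ring
  have hlim2 : Tendsto (fun T ↦ ∑ ρ ∈ weilZeroFinset T, (riemannZetaZeroOrder (ρ : ℂ) : ℂ) * F ρ)
      atTop (𝓝 (∑' ρ : riemannZetaNontrivialZeros, (riemannZetaZeroOrder (ρ : ℂ) : ℂ) * F ρ)) :=
    hsumC.hasSum.comp tendsto_weilZeroFinset
  have heq := tendsto_nhds_unique hlim2 (hlim1.congr fun T ↦ (hbox T).symm)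
  rw [← heq]
  exact hsumC.hasSum

/-- **Power sums over the zeros** (the coefficient identities behind (2.2)/(1.4)): for `k ≥ 1`,
`Σ_{ρ∈𝒵} m_ρ ρ^{−(k+1)} = 1 − [(−1)^k η_k + (1 − 2^{−k−1}) ζ(k+1)]`, absolutely convergent.
Proof: `(ξ′/ξ)^{(k)}(1) = Σ_ρ m_ρ (−1)^k k! (1−ρ)^{−(k+1)}` termwise from the Hadamard product
(`IsHadamardSeq.hasSum_iteratedDeriv_term_one`; the pairs `{ρ, 1−ρ}` make the family symmetric),
`(ξ′/ξ)^{(k)}(1) = (log ξ)^{(k+1)}(1) = (k+1)! a_{k+1}` and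
`(k+1)a_{k+1} = q_k + (−1)^k(1 − (1−2^{−(k+1)})ζ(k+1))` (`Xiao2020.logXiTaylorCoeff_succ`),
`q_k = −η_k` (`ofReal_liEta_eq`). These are the Laurent coefficients the displayed formula (1.4)
encodes ("we observe that several similar terms appear in parallel in both formulas", p. 2 L160).
[cite: Suzuki2023b, eq. (1.4) and (1.7), p. 2 L69–89, L148–160] -/
theorem hasSum_zeroOrder_mul_inv_pow {k : ℕ} (hk : 1 ≤ k) :
    HasSum (fun ρ : riemannZetaNontrivialZeros ↦
      (riemannZetaZeroOrder (ρ : ℂ) : ℂ) * ((ρ : ℂ)⁻¹) ^ (k + 1))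
      (1 - ((-1) ^ k * (liEta k : ℂ) + (1 - 1 / 2 ^ (k + 1)) * riemannZeta ((k : ℂ) + 1))) := by
  classical
  obtain ⟨b, hb⟩ := exists_isHadamardSeq 0
  set F : ℂ → ℂ := fun ρ ↦ (ρ⁻¹) ^ (k + 1) with hF
  set c : ℂ := (-1) ^ k * (k.factorial : ℂ) with hc
  have hc0 : c ≠ 0 := mul_ne_zero (pow_ne_zero _ (by norm_num))
    (by exact_mod_cast Nat.factorial_ne_zero k)
  set G : ℕ → ℂ := fun j ↦ if b j = 0 then 0 else
      (F (IsHadamardSeq.xiZero b j) + F (1 - IsHadamardSeq.xiZero b j)) with hG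
  -- `Σ_j c · G j = (ξ'/ξ)^{(k)}(1)`
  have hD := hb.hasSum_iteratedDeriv_term_one k
  have hGsum : HasSum G (c⁻¹ * iteratedDeriv k (logDeriv riemannXi) 1) := by
    have := hD.mul_left c⁻¹
    refine this.congr_fun fun j ↦ ?_
    -- wait for direction: we show `G j = c⁻¹ * iteratedDeriv … term_j … 1`
    have hfk : (k.factorial : ℂ) ≠ 0 := by exact_mod_cast Nat.factorial_ne_zero k
    have hm1 : ((-1 : ℂ)) ^ k ≠ 0 := pow_ne_zero _ (by norm_num)
    by_cases hj : b j = 0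
    · have hzero : (fun s : ℂ ↦ -(4 * b j * (2 * s - 1)) / (1 - b j * (2 * s - 1) ^ 2)) =
          fun _ ↦ (0 : ℂ) := by
        funext s; simp [hj]
      rw [hzero, iteratedDeriv_const]
      simp [hG, hj]
    · simp only [hG, hj, if_false, hb.iteratedDeriv_term_one hj k, hF, hc]
      field_simp
      ring
  have hG0 : ∀ j, b j = 0 → G j = 0 := fun j hj ↦ by simp [hG, hj]
  set K : ℝ → Finset ℕ := fun T ↦ (hb.finite_setOf_abs_im_xiZero_le T).toFinset with hK
  have hKmem : ∀ T j, j ∈ K T ↔ b j ≠ 0 ∧ |(IsHadamardSeq.xiZero b j).im| ≤ T := fun T j ↦ by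
    rw [hK, Set.Finite.mem_toFinset]; rfl
  have hlim1 : Tendsto (fun T ↦ ∑ j ∈ K T, G j) atTop
      (𝓝 (c⁻¹ * iteratedDeriv k (logDeriv riemannXi) 1)) :=
    IsHadamardSeq.tendsto_sum_truncation hGsum hG0 K hKmem
  have hbox : ∀ T, ∑ ρ ∈ weilZeroFinset T, (riemannZetaZeroOrder (ρ : ℂ) : ℂ) * F ρ =
      ∑ j ∈ K T, G j := by
    intro T
    rw [← ZetaZeroSum.finsum_mem_weilZeroIndex_eq_sum (fun ρ ↦ (riemannZetaZeroOrder ρ : ℂ) * F ρ) T,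
      ← liZeroBox_eq_weilZeroIndex, hb.finsum_liZeroBox_eq_sum F T (K T) (hKmem T)]
    refine Finset.sum_congr rfl fun j hj ↦ ?_
    simp [hG, ((hKmem T j).1 hj).1]
  -- absolute convergence: `m/|ρ|^{k+1} ≤ m/|ρ|² ≤ 2 m/(|ρ||1−ρ|)`
  have hsumC : Summable fun ρ : riemannZetaNontrivialZeros ↦
      (riemannZetaZeroOrder (ρ : ℂ) : ℂ) * F ρ := by
    have hu := (summable_norm_zeroOrder_div_mul_one_sub).mul_left 2
    refine Summable.of_norm_bounded hu fun ρ ↦ ?_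
    have hm0 : 0 ≤ (riemannZetaZeroOrder (ρ : ℂ) : ℝ) := ZetaZeroSum.zeroOrder_nonneg ρ
    have hρ1 := one_le_norm_of_mem_nontrivialZeros ρ
    have hρ1' := one_le_norm_one_sub_of_mem_nontrivialZeros ρ
    have hρpos : 0 < ‖(ρ : ℂ)‖ := by linarith
    rw [norm_mul, Complex.norm_intCast, abs_of_nonneg hm0, hF, norm_pow, norm_inv, norm_div,
      norm_mul, Complex.norm_intCast, abs_of_nonneg hm0]
    -- `|1 − ρ| ≤ 1 + |ρ| ≤ 2|ρ|`, `|ρ|^{-(k+1)} ≤ |ρ|^{-2}`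
    have h1ρ : ‖1 - (ρ : ℂ)‖ ≤ 2 * ‖(ρ : ℂ)‖ := by
      calc ‖1 - (ρ : ℂ)‖ ≤ ‖(1 : ℂ)‖ + ‖(ρ : ℂ)‖ := norm_sub_le _ _
        _ ≤ 2 * ‖(ρ : ℂ)‖ := by rw [norm_one]; linarith
    have hpow : ‖(ρ : ℂ)‖⁻¹ ^ (k + 1) ≤ ‖(ρ : ℂ)‖⁻¹ ^ 2 :=
      pow_le_pow_of_le_one (by positivity) (inv_le_one_of_one_le₀ hρ1) (by omega)
    calc (riemannZetaZeroOrder (ρ : ℂ) : ℝ) * ‖(ρ : ℂ)‖⁻¹ ^ (k + 1)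
        ≤ (riemannZetaZeroOrder (ρ : ℂ) : ℝ) * ‖(ρ : ℂ)‖⁻¹ ^ 2 := by gcongr
      _ = (riemannZetaZeroOrder (ρ : ℂ) : ℝ) / (‖(ρ : ℂ)‖ * ‖(ρ : ℂ)‖) := by
          rw [div_eq_mul_inv, mul_inv, pow_two]
      _ ≤ (riemannZetaZeroOrder (ρ : ℂ) : ℝ) / (‖(ρ : ℂ)‖ * (‖1 - (ρ : ℂ)‖ / 2)) := by
          gcongr; linarith
      _ = 2 * ((riemannZetaZeroOrder (ρ : ℂ) : ℝ) / (‖(ρ : ℂ)‖ * ‖1 - (ρ : ℂ)‖)) := by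
          field_simp
  have hlim2 : Tendsto (fun T ↦ ∑ ρ ∈ weilZeroFinset T, (riemannZetaZeroOrder (ρ : ℂ) : ℂ) * F ρ)
      atTop (𝓝 (∑' ρ : riemannZetaNontrivialZeros, (riemannZetaZeroOrder (ρ : ℂ) : ℂ) * F ρ)) :=
    hsumC.hasSum.comp tendsto_weilZeroFinset
  have heq := tendsto_nhds_unique hlim2 (hlim1.congr fun T ↦ (hbox T).symm)
  -- the value: `c⁻¹ (ξ'/ξ)^{(k)}(1) = 1 − [(−1)^k η_k + (1 − 2^{−k−1}) ζ(k+1)]`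
  have hval : c⁻¹ * iteratedDeriv k (logDeriv riemannXi) 1 =
      1 - ((-1) ^ k * (liEta k : ℂ) + (1 - 1 / 2 ^ (k + 1)) * riemannZeta ((k : ℂ) + 1)) := by
    rw [← iteratedDeriv_succ_log_riemannXi_one k]
    have hD : iteratedDeriv (k + 1) (fun s ↦ Complex.log (riemannXi s)) 1 =
        ((k + 1).factorial : ℂ) * Xiao2020.logXiTaylorCoeff (k + 1) := by
      unfold Xiao2020.logXiTaylorCoeff
      have : ((k + 1).factorial : ℂ) ≠ 0 := by exact_mod_cast Nat.factorial_ne_zero _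
      field_simp
    have hsucc := Xiao2020.logXiTaylorCoeff_succ hk
    rw [hD, Nat.factorial_succ, hc]
    push_cast
    have hk1 : ((k : ℂ) + 1) ≠ 0 := by exact_mod_cast Nat.succ_ne_zero k
    have hfk : (k.factorial : ℂ) ≠ 0 := by exact_mod_cast Nat.factorial_ne_zero k
    have hm1 : ((-1 : ℂ) ^ k)⁻¹ = (-1) ^ k := by
      rw [← inv_pow, inv_neg, inv_one]
    have hcast : ((k + 1 : ℕ) : ℂ) = (k : ℂ) + 1 := by push_cast; ring
    rw [hcast] at hsucc
    calc ((-1 : ℂ) ^ k * (k.factorial : ℂ))⁻¹ *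
          (((k : ℂ) + 1) * (k.factorial : ℂ) * Xiao2020.logXiTaylorCoeff (k + 1))
        = (-1) ^ k * (((k : ℂ) + 1) * Xiao2020.logXiTaylorCoeff (k + 1)) := by
          rw [mul_inv, hm1]; field_simp
      _ = 1 - ((-1) ^ k * (liEta k : ℂ) + (1 - 1 / 2 ^ (k + 1)) * riemannZeta ((k : ℂ) + 1)) := by
          rw [hsucc, ofReal_liEta_eq]
          have hsq : ((-1 : ℂ) ^ k) * (-1) ^ k = 1 := by
            rw [← mul_pow, neg_one_mul, neg_neg, one_pow]
          linear_combination (1 - (1 - 1 / 2 ^ (k + 1)) * riemannZeta ((k : ℂ) + 1) +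
            Xiao2020.zetaOneLogDerivCoeff k * 0) * hsq
  rw [← hval, ← heq]
  exact hsumC.hasSum

/-! ### Finite algebra behind Proposition 2.1 -/

/-- Binomial expansion: `1 − (1 − x)ⁿ = 1 + Σ_{j ≤ n} C(n,j) (−1)^{j+1} x^j` (the `j = 0` term of the
sum is `−1`). [folklore] -/
private theorem su23b_binom₁ (x : ℂ) (n : ℕ) :
    1 - (1 - x) ^ n =
      1 + ∑ j ∈ Finset.range (n + 1), (n.choose j : ℂ) * (-1) ^ (j + 1) * x ^ j := by
  have h : (1 - x) ^ n = ∑ j ∈ Finset.range (n + 1), (n.choose j : ℂ) * (-1) ^ j * x ^ j := by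
    rw [show (1 : ℂ) - x = -x + 1 by ring, add_pow]
    refine Finset.sum_congr rfl fun j _ ↦ ?_
    rw [one_pow, mul_one, neg_pow]
    ring
  have h2 : ∑ j ∈ Finset.range (n + 1), (n.choose j : ℂ) * (-1) ^ (j + 1) * x ^ j =
      -∑ j ∈ Finset.range (n + 1), (n.choose j : ℂ) * (-1) ^ j * x ^ j := by
    rw [← Finset.sum_neg_distrib]
    refine Finset.sum_congr rfl fun j _ ↦ ?_
    rw [pow_succ]
    ring
  rw [h, h2]
  ring

/-- Binomial expansion, shifted: `Σ_{i < n} C(n,i+1) (−1)^i x^{i+1} = 1 − (1 − x)ⁿ`. [folklore] -/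
private theorem su23b_binom₂ (x : ℂ) (n : ℕ) :
    ∑ i ∈ Finset.range n, (n.choose (i + 1) : ℂ) * (-1) ^ i * x ^ (i + 1) = 1 - (1 - x) ^ n := by
  rw [su23b_binom₁, Finset.sum_range_succ']
  simp only [Nat.choose_zero_right, Nat.cast_one, pow_zero, zero_add, pow_one, mul_one, one_mul]
  have : ∀ i : ℕ, ((-1 : ℂ)) ^ (i + 1 + 1) = (-1) ^ i := fun i ↦ by
    rw [pow_succ, pow_succ]; ring
  simp only [this]
  ring

/-- Telescoping closed form: `(s − ρ) Σ_{k=1}^{i} ρ^{−(k+1)} s^k = ρ^{−(i+1)} s^{i+1} − s/ρ`.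
[folklore] -/
private theorem su23b_telescope {s ρ : ℂ} (hρ : ρ ≠ 0) (i : ℕ) :
    (s - ρ) * ∑ k ∈ Icc 1 i, 1 / ρ ^ (k + 1) * s ^ k =
      s ^ (i + 1) / ρ ^ (i + 1) - s / ρ := by
  induction i with
  | zero => simp
  | succ i ih =>
    rw [Finset.sum_Icc_succ_top (by omega : 1 ≤ i + 1), mul_add, ih]
    field_simp
    ring

/-- The `j`-th termwise identity (`j = i + 1 ≥ 1`):
`s^{−j}(1/(s−ρ) + 1/ρ) − ρ^{−j}/(s−ρ) = −s^{−j} Σ_{k=1}^{j−1} ρ^{−(k+1)} s^k`. [folklore] -/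
private theorem su23b_termwise_aux {s ρ : ℂ} (hs : s ≠ 0) (hρ : ρ ≠ 0) (hsρ : s ≠ ρ) (i : ℕ) :
    (1 / s) ^ (i + 1) * (1 / (s - ρ) + 1 / ρ) - (1 / ρ) ^ (i + 1) / (s - ρ) =
      -((1 : ℂ) / s ^ (i + 1)) * ∑ k ∈ Icc 1 i, 1 / ρ ^ (k + 1) * s ^ k := by
  have hsρ' : s - ρ ≠ 0 := sub_ne_zero.2 hsρ
  have hS : ∑ k ∈ Icc 1 i, 1 / ρ ^ (k + 1) * s ^ k =
      (s ^ (i + 1) / ρ ^ (i + 1) - s / ρ) / (s - ρ) := by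
    rw [eq_div_iff hsρ', mul_comm]
    exact su23b_telescope hρ i
  rw [hS, one_div_pow, one_div_pow]
  field_simp
  ring

/-- **The termwise identity behind (2.2)**: for `s, ρ ≠ 0`, `s ≠ ρ`,
`[1−(1−1/s)ⁿ](1/(s−ρ) + 1/ρ) − [1−(1−1/ρ)ⁿ]/(s−ρ)
 = −Σ_{j ≤ n} C(n,j)(−1)^{j+1} s^{−j} Σ_{k=1}^{j−1} ρ^{−(k+1)} s^k`
(a polynomial in `1/s`, `1/ρ` without constant term in `1/ρ²`: the poles at `ρ` cancel). [folklore] -/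
private theorem su23b_termwise {s ρ : ℂ} (hs : s ≠ 0) (hρ : ρ ≠ 0) (hsρ : s ≠ ρ) (n : ℕ) :
    (1 - (1 - 1 / s) ^ n) * (1 / (s - ρ) + 1 / ρ) - (1 - (1 - 1 / ρ) ^ n) / (s - ρ) =
      -∑ j ∈ Finset.range (n + 1), (n.choose j : ℂ) * (-1) ^ (j + 1) / s ^ j *
        ∑ k ∈ Icc 1 (j - 1), 1 / ρ ^ (k + 1) * s ^ k := by
  have hsρ' : s - ρ ≠ 0 := sub_ne_zero.2 hsρ
  rw [su23b_binom₁ (1 / s) n, su23b_binom₁ (1 / ρ) n, Finset.sum_range_succ', Finset.sum_range_succ',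
    Finset.sum_range_succ' (fun j ↦ (n.choose j : ℂ) * (-1) ^ (j + 1) / s ^ j *
      ∑ k ∈ Icc 1 (j - 1), 1 / ρ ^ (k + 1) * s ^ k)]
  have hI0 : Finset.Icc 1 (0 - 1) = (∅ : Finset ℕ) := by decide
  simp only [Nat.choose_zero_right, Nat.cast_one, pow_zero, zero_add, pow_one, mul_one, one_mul,
    Nat.add_sub_cancel, hI0, Finset.sum_empty, mul_zero, add_zero, div_one]
  have key : ∀ i ∈ Finset.range n,
      (n.choose (i + 1) : ℂ) * (-1) ^ (i + 1 + 1) * (1 / s) ^ (i + 1) * (1 / (s - ρ) + 1 / ρ) -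
        (n.choose (i + 1) : ℂ) * (-1) ^ (i + 1 + 1) * (1 / ρ) ^ (i + 1) / (s - ρ) =
      -((n.choose (i + 1) : ℂ) * (-1) ^ (i + 1 + 1) / s ^ (i + 1) *
        ∑ k ∈ Icc 1 i, 1 / ρ ^ (k + 1) * s ^ k) := by
    intro i _
    have h := su23b_termwise_aux hs hρ hsρ i
    calc (n.choose (i + 1) : ℂ) * (-1) ^ (i + 1 + 1) * (1 / s) ^ (i + 1) * (1 / (s - ρ) + 1 / ρ) -
          (n.choose (i + 1) : ℂ) * (-1) ^ (i + 1 + 1) * (1 / ρ) ^ (i + 1) / (s - ρ)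
        = (n.choose (i + 1) : ℂ) * (-1) ^ (i + 1 + 1) *
            ((1 / s) ^ (i + 1) * (1 / (s - ρ) + 1 / ρ) - (1 / ρ) ^ (i + 1) / (s - ρ)) := by ring
      _ = (n.choose (i + 1) : ℂ) * (-1) ^ (i + 1 + 1) *
            (-((1 : ℂ) / s ^ (i + 1)) * ∑ k ∈ Icc 1 i, 1 / ρ ^ (k + 1) * s ^ k) := by rw [h]
      _ = _ := by ring
  rw [← Finset.sum_neg_distrib, ← Finset.sum_congr rfl key, Finset.sum_sub_distrib, ← Finset.sum_mul,
    ← Finset.sum_div]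
  -- the `j = 0` terms: `(1 + (A − 1))·X − (1 + (B − 1))/(s−ρ) = A·X − B/(s−ρ)`
  ring

/-- `Σ_{j ∈ Icc 2 n} g j = Σ_{j ≤ n} g j` when `g 0 = g 1 = 0`. [folklore] -/
private theorem su23b_sum_Icc_two {g : ℕ → ℂ} (h0 : g 0 = 0) (h1 : g 1 = 0) {n : ℕ} (hn : 1 ≤ n) :
    ∑ j ∈ Icc 2 n, g j = ∑ j ∈ Finset.range (n + 1), g j := by
  rw [Finset.range_eq_Ico, ← Finset.sum_Ico_consecutive g (by norm_num : 0 ≤ 2)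
    (by omega : 2 ≤ n + 1), Finset.Ico_add_one_right_eq_Icc]
  have : ∑ j ∈ Finset.Ico 0 2, g j = 0 := by
    rw [show Finset.Ico 0 2 = {0, 1} by decide, Finset.sum_pair (by norm_num), h0, h1, add_zero]
  rw [this, zero_add]

/-- **The combinatorial identity behind (2.2)**: for `s ≠ 0, 1`, `n ≥ 1`,
`Σ_{j ≤ n} C(n,j)(−1)^{j+1} s^{−j} Σ_{k=1}^{j−1} s^k = (1 − 1/s)^{n−1} − 1`. [folklore] -/
private theorem su23b_combinatorial {s : ℂ} (hs : s ≠ 0) (hs1 : s ≠ 1) {n : ℕ} (hn : 1 ≤ n) :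
    ∑ j ∈ Finset.range (n + 1), (n.choose j : ℂ) * (-1) ^ (j + 1) / s ^ j *
        ∑ k ∈ Icc 1 (j - 1), s ^ k = (1 - 1 / s) ^ (n - 1) - 1 := by
  obtain ⟨m, rfl⟩ : ∃ m, n = m + 1 := ⟨n - 1, by omega⟩
  have hs1' : s - 1 ≠ 0 := sub_ne_zero.2 hs1
  rw [Nat.add_sub_cancel, Finset.sum_range_succ']
  have hI0 : Finset.Icc 1 (0 - 1) = (∅ : Finset ℕ) := by decide
  simp only [hI0, Finset.sum_empty, mul_zero, add_zero, Nat.add_sub_cancel]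
  have hgeom : ∀ i : ℕ, ∑ k ∈ Icc 1 i, s ^ k = (s ^ (i + 1) - s) / (s - 1) := by
    intro i
    rw [← Finset.Ico_add_one_right_eq_Icc, geom_sum_Ico hs1 (by omega : 1 ≤ i + 1), pow_one]
  simp only [hgeom]
  have hterm : ∀ i ∈ Finset.range (m + 1),
      ((m + 1).choose (i + 1) : ℂ) * (-1) ^ (i + 1 + 1) / s ^ (i + 1) * ((s ^ (i + 1) - s) / (s - 1)) =
        (1 / (s - 1)) * (((m + 1).choose (i + 1) : ℂ) * (-1) ^ i * 1 ^ (i + 1)) -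
          (s / (s - 1)) * (((m + 1).choose (i + 1) : ℂ) * (-1) ^ i * (1 / s) ^ (i + 1)) := by
    intro i _
    have : ((-1 : ℂ)) ^ (i + 1 + 1) = (-1) ^ i := by rw [pow_succ, pow_succ]; ring
    rw [this, one_div_pow, one_pow, mul_one]
    field_simp
  rw [Finset.sum_congr rfl hterm, Finset.sum_sub_distrib, ← Finset.mul_sum, ← Finset.mul_sum,
    su23b_binom₂ (1 : ℂ) (m + 1), su23b_binom₂ (1 / s) (m + 1)]
  simp only [sub_self, zero_pow (Nat.succ_ne_zero m), sub_zero]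
  rw [pow_succ]
  field_simp
  ring

/-- The `P_n`-sum of (1.4) rewritten over `j ≤ n` with the sign `(−1)^{j+1}` (for `j ∈ {0,1}` the
inner sum is empty). [folklore] -/
private theorem su23b_P_eq {s : ℂ} {n : ℕ} (hn : 1 ≤ n) (c : ℕ → ℂ) :
    ∑ j ∈ Icc 2 n, (n.choose j : ℂ) * (-1) ^ (j - 1) / s ^ j *
        ∑ k ∈ Icc 1 (j - 1), c k * s ^ k =
      ∑ j ∈ Finset.range (n + 1), (n.choose j : ℂ) * (-1) ^ (j + 1) / s ^ j *
        ∑ k ∈ Icc 1 (j - 1), c k * s ^ k := by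
  have h1 : ∑ j ∈ Icc 2 n, (n.choose j : ℂ) * (-1) ^ (j - 1) / s ^ j *
        ∑ k ∈ Icc 1 (j - 1), c k * s ^ k =
      ∑ j ∈ Icc 2 n, (n.choose j : ℂ) * (-1) ^ (j + 1) / s ^ j *
        ∑ k ∈ Icc 1 (j - 1), c k * s ^ k := by
    refine Finset.sum_congr rfl fun j hj ↦ ?_
    have hj2 : 2 ≤ j := (Finset.mem_Icc.1 hj).1
    have : ((-1 : ℂ)) ^ (j + 1) = (-1) ^ (j - 1) := by
      rw [show j + 1 = (j - 1) + 2 by omega, pow_add, neg_one_sq, mul_one]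
    rw [this]
  rw [h1]
  have hI0 : Finset.Icc 1 (0 - 1) = (∅ : Finset ℕ) := by decide
  have hI1 : Finset.Icc 1 (1 - 1) = (∅ : Finset ℕ) := by decide
  exact su23b_sum_Icc_two (by rw [hI0]; simp) (by rw [hI1]; simp) hn

/-! ### Proposition 2.1 -/

/-- **The identity (2.2) for the displayed formula**: for `n ≥ 1` and `s ∉ {0, 1}` with `ξ(s) ≠ 0`,
`liModelHFormula n s = i ξ(s)/(ξ(s)+ξ′(s)) · M_n(s)`. Proof (in place of the printed explicit-formula
computation): Hadamard's partial fractions for `ξ′/ξ(s) − ξ′/ξ(0)`, the termwise identity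
`su23b_termwise`, the power sums `hasSum_zeroOrder_mul_inv_pow` and `su23b_combinatorial`.
RH-FREE. [cite: Suzuki2023b, Prop. 2.1, eq. (2.2), p. 4 L41–53] -/
theorem liModelHFormula_eq_mul_liModelM {n : ℕ} (hn : 1 ≤ n) {s : ℂ} (h0 : s ≠ 0) (h1 : s ≠ 1)
    (hξ : riemannXi s ≠ 0) :
    liModelHFormula n s =
      I * riemannXi s / (riemannXi s + deriv riemannXi s) * liModelM n s := by
  classical
  have hs : s ∉ riemannZetaNontrivialZeros := (riemannXi_ne_zero_iff_not_mem s).1 hξ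
  -- (H) Hadamard
  have hH := hasSum_zeroOrder_mul_inv_sub_add_inv hξ
  -- (M) the series of `M_n`
  have hM : HasSum (fun ρ : riemannZetaNontrivialZeros ↦
      (riemannZetaZeroOrder (ρ : ℂ) : ℂ) * (1 - (1 - 1 / (ρ : ℂ)) ^ n) / (s - ρ))
      (I * liModelM n s) := by
    have : I * liModelM n s = ∑' ρ : riemannZetaNontrivialZeros,
        (riemannZetaZeroOrder (ρ : ℂ) : ℂ) * (1 - (1 - 1 / (ρ : ℂ)) ^ n) / (s - ρ) := by
      rw [liModelM, ← mul_assoc, mul_neg, Complex.I_mul_I, neg_neg, one_mul]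
    rw [this]
    exact (summable_liModelM_terms hs n).hasSum
  -- (P) the power sums, assembled into the double finite sum
  have hPsum : HasSum (fun ρ : riemannZetaNontrivialZeros ↦
      ∑ j ∈ Finset.range (n + 1), (n.choose j : ℂ) * (-1) ^ (j + 1) / s ^ j *
        ∑ k ∈ Icc 1 (j - 1), ((riemannZetaZeroOrder (ρ : ℂ) : ℂ) * (1 / (ρ : ℂ) ^ (k + 1))) * s ^ k)
      (∑ j ∈ Finset.range (n + 1), (n.choose j : ℂ) * (-1) ^ (j + 1) / s ^ j *
        ∑ k ∈ Icc 1 (j - 1),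
          (1 - ((-1) ^ k * (liEta k : ℂ) + (1 - 1 / 2 ^ (k + 1)) * riemannZeta ((k : ℂ) + 1))) *
            s ^ k) := by
    refine hasSum_sum fun j _ ↦ ?_
    refine HasSum.mul_left _ ?_
    refine hasSum_sum fun k hk ↦ ?_
    have hk1 : 1 ≤ k := (Finset.mem_Icc.1 hk).1
    have h := (hasSum_zeroOrder_mul_inv_pow hk1).mul_right (s ^ k)
    refine h.congr_fun fun ρ ↦ ?_
    rw [inv_pow, one_div]
  -- (T) termwise
  have hT : ∀ ρ : riemannZetaNontrivialZeros,
      (1 - (1 - 1 / s) ^ n) * ((riemannZetaZeroOrder (ρ : ℂ) : ℂ) * (1 / (s - ρ) + 1 / ρ)) -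
        (riemannZetaZeroOrder (ρ : ℂ) : ℂ) * (1 - (1 - 1 / (ρ : ℂ)) ^ n) / (s - ρ) =
      -∑ j ∈ Finset.range (n + 1), (n.choose j : ℂ) * (-1) ^ (j + 1) / s ^ j *
        ∑ k ∈ Icc 1 (j - 1),
          ((riemannZetaZeroOrder (ρ : ℂ) : ℂ) * (1 / (ρ : ℂ) ^ (k + 1))) * s ^ k := by
    intro ρ
    have hρ0 : (ρ : ℂ) ≠ 0 := fun h ↦ by
      have := riemannZetaNontrivialZeros.re_pos ρ.2; rw [h] at this; simp at this
    have hsρ : s ≠ ρ := fun h ↦ hs (h ▸ ρ.2)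
    have h := su23b_termwise h0 hρ0 hsρ n
    calc (1 - (1 - 1 / s) ^ n) * ((riemannZetaZeroOrder (ρ : ℂ) : ℂ) * (1 / (s - ρ) + 1 / ρ)) -
          (riemannZetaZeroOrder (ρ : ℂ) : ℂ) * (1 - (1 - 1 / (ρ : ℂ)) ^ n) / (s - ρ)
        = (riemannZetaZeroOrder (ρ : ℂ) : ℂ) *
            ((1 - (1 - 1 / s) ^ n) * (1 / (s - ρ) + 1 / ρ) - (1 - (1 - 1 / (ρ : ℂ)) ^ n) / (s - ρ)) := by
          ring
      _ = (riemannZetaZeroOrder (ρ : ℂ) : ℂ) *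
            -∑ j ∈ Finset.range (n + 1), (n.choose j : ℂ) * (-1) ^ (j + 1) / s ^ j *
              ∑ k ∈ Icc 1 (j - 1), 1 / (ρ : ℂ) ^ (k + 1) * s ^ k := by rw [h]
      _ = _ := by
          rw [mul_neg, Finset.mul_sum]
          congr 1
          refine Finset.sum_congr rfl fun j _ ↦ ?_
          rw [Finset.mul_sum, Finset.mul_sum, Finset.mul_sum]
          refine Finset.sum_congr rfl fun k _ ↦ ?_
          ring
  -- uniqueness of sums: `bS·L − I·M = −(double sum with 1 − c_k)`
  have hleft := (hH.mul_left (1 - (1 - 1 / s) ^ n)).sub hM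
  have hright : HasSum (fun ρ : riemannZetaNontrivialZeros ↦
      (1 - (1 - 1 / s) ^ n) * ((riemannZetaZeroOrder (ρ : ℂ) : ℂ) * (1 / (s - ρ) + 1 / ρ)) -
        (riemannZetaZeroOrder (ρ : ℂ) : ℂ) * (1 - (1 - 1 / (ρ : ℂ)) ^ n) / (s - ρ))
      (-(∑ j ∈ Finset.range (n + 1), (n.choose j : ℂ) * (-1) ^ (j + 1) / s ^ j *
        ∑ k ∈ Icc 1 (j - 1),
          (1 - ((-1) ^ k * (liEta k : ℂ) + (1 - 1 / 2 ^ (k + 1)) * riemannZeta ((k : ℂ) + 1))) *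
            s ^ k)) :=
    hPsum.neg.congr_fun hT
  have hval := hleft.unique hright
  -- the combinatorial part of the double sum
  have hsplit : ∑ j ∈ Finset.range (n + 1), (n.choose j : ℂ) * (-1) ^ (j + 1) / s ^ j *
        ∑ k ∈ Icc 1 (j - 1),
          (1 - ((-1) ^ k * (liEta k : ℂ) + (1 - 1 / 2 ^ (k + 1)) * riemannZeta ((k : ℂ) + 1))) *
            s ^ k =
      ((1 - 1 / s) ^ (n - 1) - 1) -
        ∑ j ∈ Finset.range (n + 1), (n.choose j : ℂ) * (-1) ^ (j + 1) / s ^ j *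
          ∑ k ∈ Icc 1 (j - 1),
            ((-1) ^ k * (liEta k : ℂ) + (1 - 1 / 2 ^ (k + 1)) * riemannZeta ((k : ℂ) + 1)) * s ^ k := by
    rw [← su23b_combinatorial h0 h1 hn, ← Finset.sum_sub_distrib]
    refine Finset.sum_congr rfl fun j _ ↦ ?_
    rw [← mul_sub, ← Finset.sum_sub_distrib]
    congr 1
    refine Finset.sum_congr rfl fun k _ ↦ ?_
    ring
  rw [hsplit] at hval
  -- the displayed formula
  unfold liModelHFormula
  rw [su23b_P_eq hn]
  -- name the `P`-sum and finish by algebra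
  set P : ℂ := ∑ j ∈ Finset.range (n + 1), (n.choose j : ℂ) * (-1) ^ (j + 1) / s ^ j *
      ∑ k ∈ Icc 1 (j - 1),
        ((-1) ^ k * (liEta k : ℂ) + (1 - 1 / 2 ^ (k + 1)) * riemannZeta ((k : ℂ) + 1)) * s ^ k with hP
  have hIM : I * liModelM n s =
      (1 - (1 - 1 / s) ^ n) * (logDeriv riemannXi s - logDeriv riemannXi 0) +
        (((1 - 1 / s) ^ (n - 1) - 1) - P) := by
    linear_combination (-1 : ℂ) * hval
  have hξ0 : riemannXi 0 ≠ 0 := by rw [riemannXi_zero]; norm_num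
  have hs1' : s - 1 ≠ 0 := sub_ne_zero.2 h1
  rw [show I * riemannXi s / (riemannXi s + deriv riemannXi s) * liModelM n s =
      riemannXi s / (riemannXi s + deriv riemannXi s) * (I * liModelM n s) by ring, hIM,
    logDeriv_apply, logDeriv_apply]
  congr 1
  obtain ⟨m, rfl⟩ : ∃ m, n = m + 1 := ⟨n - 1, by omega⟩
  rw [Nat.add_sub_cancel, pow_succ]
  field_simp
  ring

/-! ## Proposition 2.1 — the discharge, and (3.6) -/

/-- `M_n` is differentiable at every point off `𝒵` (Lemma 2.1 (ii), localized: `𝒵` has no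
accumulation point, so `ℂ ∖ 𝒵` is a neighbourhood of each of its points). RH-FREE.
[cite: Suzuki2023b, Lemma 2.1, p. 4 L16–38] -/
theorem differentiableAt_liModelM {n : ℕ} (hn : 1 ≤ n) {s : ℂ}
    (hs : s ∉ riemannZetaNontrivialZeros) : DifferentiableAt ℂ (liModelM n) s := by
  obtain ⟨δ, hδ, -, hsep⟩ := exists_pos_le_norm_sub_of_nontrivialZeros s
  refine ((Suzuki2023b_lemma21_holds n hn).2.1).differentiableAt ?_
  refine Filter.mem_of_superset (Metric.ball_mem_nhds s hδ) fun w hw hwZ ↦ ?_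
  rcases eq_or_ne w s with rfl | hne
  · exact hs hwZ
  · have h2 := hsep w hwZ hne
    rw [Metric.mem_ball, dist_eq_norm] at hw
    linarith

/-- Every point has a punctured neighbourhood free of non-trivial zeros. [folklore] -/
private theorem eventually_not_mem_nontrivialZeros (s : ℂ) :
    ∀ᶠ w in 𝓝[≠] s, w ∉ riemannZetaNontrivialZeros := by
  obtain ⟨δ, hδ, -, hsep⟩ := exists_pos_le_norm_sub_of_nontrivialZeros s
  have hball : Metric.ball s δ ∈ 𝓝[≠] s :=
    mem_nhdsWithin_of_mem_nhds (Metric.ball_mem_nhds s hδ)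
  filter_upwards [hball, self_mem_nhdsWithin] with w hw hne hwZ
  have h2 := hsep w hwZ hne
  rw [Metric.mem_ball, dist_eq_norm] at hw
  linarith

/-- In a punctured neighbourhood of `s` every point is `≠ a`. [folklore] -/
private theorem eventually_ne_nhdsNE (s a : ℂ) : ∀ᶠ w in 𝓝[≠] s, w ≠ a := by
  rcases eq_or_ne s a with rfl | h
  · exact self_mem_nhdsWithin
  · exact (eventually_ne_nhds h).filter_mono nhdsWithin_le_nhds

/-- The series of `M_n` sums, off `𝒵`, to `i·M_n(s)`:
`Σ_ρ m_ρ[1−(1−1/ρ)ⁿ]/(s−ρ) = i M_n(s)` (definition of `M_n` and Lemma 2.1 (i)). RH-FREE.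
[cite: Suzuki2023b, eq. (2.1), p. 4 L8–14] -/
theorem hasSum_liModelM_terms {n : ℕ} {s : ℂ} (hs : s ∉ riemannZetaNontrivialZeros) :
    HasSum (fun ρ : riemannZetaNontrivialZeros ↦
      (riemannZetaZeroOrder (ρ : ℂ) : ℂ) * (1 - (1 - 1 / (ρ : ℂ)) ^ n) / (s - ρ))
      (I * liModelM n s) := by
  have : I * liModelM n s = ∑' ρ : riemannZetaNontrivialZeros,
      (riemannZetaZeroOrder (ρ : ℂ) : ℂ) * (1 - (1 - 1 / (ρ : ℂ)) ^ n) / (s - ρ) := by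
    rw [liModelM, ← mul_assoc, mul_neg, Complex.I_mul_I, neg_neg, one_mul]
  rw [this]
  exact (summable_liModelM_terms hs n).hasSum

/-- **[Su23b] Proposition 2.1 (discharge of `Suzuki2023b_prop21`)**: for `n ≥ 1`,
(i) `H_n(s) = i·ξ(s)/(ξ(s)+ξ′(s))·M_n(s)` at every `s` with `ξ(s) ≠ 0`, `ξ(s)+ξ′(s) ≠ 0`
(including `s = 0, 1`, where `H_n` is the limit of the formula (1.4)); (ii) every `ρ ∈ 𝒵` is a
removable singularity of the formula. Proof: (i) off `{0,1}` the identity of functions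
`liModelHFormula_eq_mul_liModelM` holds on a punctured neighbourhood of `s` and the right-hand
side is continuous at `s`, so the punctured limit defining `H_n` is its value; (ii) by (2.9)
(`Suzuki2023b_eq_s212_holds`) and the residue of `M_n` (Lemma 2.1 (iii)),
`i·[ξ/((ξ+ξ′)(s−ρ))]·[(s−ρ)M_n(s)] → i·(1/m_ρ)·(−i m_ρ[1−(1−1/ρ)ⁿ])`. RH-FREE.
[cite: Suzuki2023b, Prop. 2.1, eq. (2.2), p. 4 L41–53; p. 6 L26–38] -/
theorem Suzuki2023b_prop21_holds : Suzuki2023b_prop21 := by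
  intro n hn
  have hξc : Continuous riemannXi := differentiable_riemannXi.continuous
  have hξ'c : Continuous (deriv riemannXi) :=
    ((differentiable_riemannXi.contDiff (n := 2)).differentiable_deriv_two).continuous
  refine ⟨fun s hξ hE ↦ ?_, fun ρ hρ ↦ ?_⟩
  · -- (i) the value at a point where `ξ ≠ 0`, `ξ + ξ′ ≠ 0`
    have hs : s ∉ riemannZetaNontrivialZeros := (riemannXi_ne_zero_iff_not_mem s).1 hξ
    have hR : ContinuousAt (fun w ↦ I * riemannXi w / (riemannXi w + deriv riemannXi w) *
        liModelM n w) s :=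
      ((continuousAt_const.mul hξc.continuousAt).div₀ (hξc.continuousAt.add hξ'c.continuousAt)
        hE).mul (differentiableAt_liModelM hn hs).continuousAt
    have hev : (fun w ↦ I * riemannXi w / (riemannXi w + deriv riemannXi w) * liModelM n w)
        =ᶠ[𝓝[≠] s] liModelHFormula n := by
      filter_upwards [eventually_ne_nhdsNE s 0, eventually_ne_nhdsNE s 1,
        (hξc.continuousAt.eventually_ne hξ).filter_mono nhdsWithin_le_nhds] with w hw0 hw1 hwξ
      exact (liModelHFormula_eq_mul_liModelM hn hw0 hw1 hwξ).symm
    unfold liModelH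
    exact (Filter.Tendsto.congr' hev (hR.tendsto.mono_left nhdsWithin_le_nhds)).limUnder_eq
  · -- (ii) removability at `ρ ∈ 𝒵`
    have h212 := Suzuki2023b_eq_s212_holds ρ hρ
    have hres := (Suzuki2023b_lemma21_holds n hn).2.2 ρ hρ
    have hprod := (h212.mul hres).const_mul I
    have hev : (fun w ↦ I * (riemannXi w / ((riemannXi w + deriv riemannXi w) * (w - ρ)) *
          ((w - ρ) * liModelM n w))) =ᶠ[𝓝[≠] ρ] liModelHFormula n := by
      filter_upwards [eventually_ne_nhdsNE ρ 0, eventually_ne_nhdsNE ρ 1,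
        eventually_not_mem_nontrivialZeros ρ, self_mem_nhdsWithin] with w hw0 hw1 hwZ hne
      have hwρ : w - ρ ≠ 0 := sub_ne_zero.mpr hne
      rw [liModelHFormula_eq_mul_liModelM hn hw0 hw1 ((riemannXi_ne_zero_iff_not_mem w).2 hwZ)]
      have : riemannXi w / ((riemannXi w + deriv riemannXi w) * (w - ρ)) *
            ((w - ρ) * liModelM n w) =
          riemannXi w * liModelM n w / (riemannXi w + deriv riemannXi w) := by
        rw [div_mul_eq_mul_div, show riemannXi w * ((w - ρ) * liModelM n w) =
          riemannXi w * liModelM n w * (w - ρ) by ring, mul_div_mul_right _ _ hwρ]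
      rw [this]
      ring
    exact ⟨_, Filter.Tendsto.congr' hev hprod⟩

/-- **[Su23b] eq. (3.6) (discharge of `Suzuki2023b_eq0225_1`)**: at every `z` with
`ξ(½ − iz) ≠ 0` and `E(z) ≠ 0`,
`G_n(z) = Σ_γ m_γ [1 − (1 − 1/(½ − iγ))ⁿ] · i(1+Θ(z))/(2(z−γ))` (sum over the distinct zeros with
multiplicity, absolutely convergent). From Prop. 2.1 (i) at `s = ½ − iz`, `E(z) = ξ(s)+ξ′(s)`,
`1 + Θ(z) = 2ξ(s)/E(z)` (`E♯(z) = ξ(s) − ξ′(s)`, `sharp_lagariasE`) and `z − γ_ρ = i(s − ρ)`.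
RH-FREE. [cite: Suzuki2023b, eq. (3.6), p. 8 L85–96; §4.2, p. 10 L93–100] -/
theorem Suzuki2023b_eq0225_1_holds : Suzuki2023b_eq0225_1 := by
  intro n hn z hξ hE
  set s : ℂ := 1 / 2 - I * z with hs_def
  have hs : s ∉ riemannZetaNontrivialZeros := (riemannXi_ne_zero_iff_not_mem s).1 hξ
  have hE' : riemannXi s + deriv riemannXi s ≠ 0 := hE
  have hG : liModelG n z = I * riemannXi s / (riemannXi s + deriv riemannXi s) * liModelM n s :=
    (Suzuki2023b_prop21_holds n hn).1 s hξ hE'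
  have hΘ : 1 + lagariasTheta z = 2 * riemannXi s / (riemannXi s + deriv riemannXi s) := by
    rw [lagariasTheta, Literature.NumberTheory.LFunctions.sharp_lagariasE]
    change 1 + (riemannXi s - deriv riemannXi s) / (riemannXi s + deriv riemannXi s) = _
    field_simp
    ring
  have hγ : ∀ ρ : ℂ, z - suzukiZeroParam ρ = I * (s - ρ) := fun ρ ↦ by
    rw [suzukiZeroParam, hs_def]
    linear_combination z * Complex.I_mul_I
  have hM := (hasSum_liModelM_terms (n := n) hs).mul_left
    (riemannXi s / (riemannXi s + deriv riemannXi s))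
  have hval : riemannXi s / (riemannXi s + deriv riemannXi s) * (I * liModelM n s) =
      liModelG n z := by rw [hG]; ring
  rw [← hval]
  refine hM.congr_fun fun ρ ↦ ?_
  have hsρ : s - (ρ : ℂ) ≠ 0 := sub_ne_zero.mpr fun h ↦ hs (h ▸ ρ.2)
  rw [hΘ, hγ]
  field_simp

/-! ## Proposition 2.2 — analyticity of `H_n` at the points of the critical line -/

/-- `H_n` is complex-differentiable at every `s` with `ξ(s) ≠ 0` and `ξ(s)+ξ′(s) ≠ 0`: on the open
set of such points `H_n = i ξ/(ξ+ξ′)·M_n` (Prop. 2.1 (i)) and `M_n` is holomorphic off `𝒵`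
(Lemma 2.1 (ii)). RH-FREE. [cite: Suzuki2023b, Prop. 2.3 (3), p. 6 L112–114] -/
theorem differentiableAt_liModelH {n : ℕ} (hn : 1 ≤ n) {s : ℂ} (hξ : riemannXi s ≠ 0)
    (hE : riemannXi s + deriv riemannXi s ≠ 0) : DifferentiableAt ℂ (liModelH n) s := by
  have hξc : Continuous riemannXi := differentiable_riemannXi.continuous
  have hξ'd : Differentiable ℂ (deriv riemannXi) :=
    (differentiable_riemannXi.contDiff (n := 2)).differentiable_deriv_two
  have hs : s ∉ riemannZetaNontrivialZeros := (riemannXi_ne_zero_iff_not_mem s).1 hξ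
  have hev : liModelH n =ᶠ[𝓝 s]
      fun w ↦ I * riemannXi w / (riemannXi w + deriv riemannXi w) * liModelM n w := by
    filter_upwards [hξc.continuousAt.eventually_ne hξ,
      (hξc.add hξ'd.continuous).continuousAt.eventually_ne hE] with w hwξ hwE
    exact (Suzuki2023b_prop21_holds n hn).1 w hwξ hwE
  refine DifferentiableAt.congr_of_eventuallyEq ?_ hev
  exact (((differentiableAt_const I).mul (differentiable_riemannXi s)).div
    ((differentiable_riemannXi s).add (hξ'd s)) hE).mul (differentiableAt_liModelM hn hs)

/-- `H_n` is analytic at every `s` with `ξ(s) ≠ 0` and `ξ(s)+ξ′(s) ≠ 0` (an open set on which it is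
complex-differentiable). RH-FREE. [cite: Suzuki2023b, Prop. 2.3 (3), p. 6 L112–114] -/
theorem analyticAt_liModelH {n : ℕ} (hn : 1 ≤ n) {s : ℂ} (hξ : riemannXi s ≠ 0)
    (hE : riemannXi s + deriv riemannXi s ≠ 0) : AnalyticAt ℂ (liModelH n) s := by
  have hξc : Continuous riemannXi := differentiable_riemannXi.continuous
  have hξ'c : Continuous (deriv riemannXi) :=
    ((differentiable_riemannXi.contDiff (n := 2)).differentiable_deriv_two).continuous
  rw [Complex.analyticAt_iff_eventually_differentiableAt]
  filter_upwards [hξc.continuousAt.eventually_ne hξ,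
    (hξc.add hξ'c).continuousAt.eventually_ne hE] with w hwξ hwE
  exact differentiableAt_liModelH hn hwξ hwE

/-- Near a zero `ρ ∈ 𝒵`, `ξ + ξ′` does not vanish on a punctured neighbourhood (by (2.9):
`ξ/((ξ+ξ′)(s−ρ)) → 1/m_ρ ≠ 0`). [cite: Suzuki2023b, eq. (2.9), p. 6 L26–38] -/
theorem eventually_xi_add_deriv_ne_zero {ρ : ℂ} (hρ : ρ ∈ riemannZetaNontrivialZeros) :
    ∀ᶠ w in 𝓝[≠] ρ, riemannXi w + deriv riemannXi w ≠ 0 := by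
  have h212 := Suzuki2023b_eq_s212_holds ρ hρ
  have hm : (1 / (riemannZetaZeroOrder ρ : ℂ)) ≠ 0 := by
    have := FordL33.order_pos ⟨ρ, hρ⟩
    have h : (riemannZetaZeroOrder ρ : ℂ) ≠ 0 := by exact_mod_cast this.ne'
    exact one_div_ne_zero h
  filter_upwards [h212.eventually_ne hm] with w hw hE
  rw [hE, zero_mul, div_zero] at hw
  exact hw rfl

/-- **Removability (Prop. 2.1 / Prop. 2.3 (3)): `H_n` is analytic at every `ρ ∈ 𝒵`.** On a
punctured neighbourhood of `ρ` the function `H_n` is complex-differentiable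
(`differentiableAt_liModelH`), and it is continuous at `ρ` because its value there is the
punctured limit of the formula (Prop. 2.1 (ii) and the definition of `liModelH`); Riemann's
removable singularity theorem. RH-FREE.
[cite: Suzuki2023b, Prop. 2.1, p. 4 L53; Prop. 2.3 (3), p. 6 L112–114] -/
theorem analyticAt_liModelH_of_mem {n : ℕ} (hn : 1 ≤ n) {ρ : ℂ}
    (hρ : ρ ∈ riemannZetaNontrivialZeros) : AnalyticAt ℂ (liModelH n) ρ := by
  apply Complex.analyticAt_of_differentiable_on_punctured_nhds_of_continuousAt
  · filter_upwards [eventually_not_mem_nontrivialZeros ρ, eventually_xi_add_deriv_ne_zero hρ]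
      with w hwZ hwE
    exact differentiableAt_liModelH hn ((riemannXi_ne_zero_iff_not_mem w).2 hwZ) hwE
  · obtain ⟨c, hc⟩ := (Suzuki2023b_prop21_holds n hn).2 ρ hρ
    have hval : liModelH n ρ = c := by
      unfold liModelH
      exact hc.limUnder_eq
    have hev : liModelHFormula n =ᶠ[𝓝[≠] ρ] liModelH n := by
      filter_upwards [eventually_ne_nhdsNE ρ 0, eventually_ne_nhdsNE ρ 1,
        eventually_not_mem_nontrivialZeros ρ, eventually_xi_add_deriv_ne_zero hρ]
        with w hw0 hw1 hwZ hwE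
      exact (liModelH_eq_formula_of_ne n hw0 hw1 ((riemannXi_ne_zero_iff_not_mem w).2 hwZ)
        hwE).symm
    have : Tendsto (liModelH n) (𝓝[≠] ρ) (𝓝 (liModelH n ρ)) := by
      rw [hval]
      exact Filter.Tendsto.congr' hev hc
    exact continuousWithinAt_compl_self.mp this

/-- On the critical line `ξ` is real and `ξ′` purely imaginary, so `|ξ(s)+ξ′(s)|² = |ξ(s)|² +
|ξ′(s)|²`: `‖ξ(s)‖ ≤ ‖ξ(s)+ξ′(s)‖` and `‖ξ′(s)‖ ≤ ‖ξ(s)+ξ′(s)‖` at `s = ½ − ix`, `x ∈ ℝ` (the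
printed "`|(ξ(1−s)+ξ′(1−s))/(ξ(s)+ξ′(s))| = 1`, so that `2H_n = …`", p. 6 L52–60, in the form
used). RH-FREE. [cite: Suzuki2023b, Prop. 2.2 (proof), p. 6 L52–60] -/
theorem norm_riemannXi_le_norm_add_deriv_critical (x : ℝ) :
    ‖riemannXi (1 / 2 - I * x)‖ ≤ ‖riemannXi (1 / 2 - I * x) + deriv riemannXi (1 / 2 - I * x)‖ ∧
    ‖deriv riemannXi (1 / 2 - I * x)‖ ≤
      ‖riemannXi (1 / 2 - I * x) + deriv riemannXi (1 / 2 - I * x)‖ := by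
  set a := riemannXi (1 / 2 - I * x) with ha_def
  set b := deriv riemannXi (1 / 2 - I * x) with hb_def
  have ha : conj a = a := conj_riemannXi_critical x
  have hb : conj b = -b := conj_deriv_riemannXi_critical x
  have ha' : a.im = 0 := by
    have := congrArg Complex.im ha
    simp only [Complex.conj_im] at this
    linarith
  have hb' : b.re = 0 := by
    have := congrArg Complex.re hb
    simp only [Complex.conj_re, Complex.neg_re] at this
    linarith
  have hre : (a * conj b).re = 0 := by
    simp [Complex.mul_re, ha', hb']
  have hsq : Complex.normSq (a + b) = Complex.normSq a + Complex.normSq b := by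
    rw [Complex.normSq_add, hre]; ring
  have h1 : ‖a‖ ^ 2 ≤ ‖a + b‖ ^ 2 := by
    rw [Complex.sq_norm, Complex.sq_norm, hsq]
    exact le_add_of_nonneg_right (Complex.normSq_nonneg b)
  have h2 : ‖b‖ ^ 2 ≤ ‖a + b‖ ^ 2 := by
    rw [Complex.sq_norm, Complex.sq_norm, hsq]
    exact le_add_of_nonneg_left (Complex.normSq_nonneg a)
  exact ⟨(sq_le_sq₀ (norm_nonneg _) (norm_nonneg _)).1 h1,
    (sq_le_sq₀ (norm_nonneg _) (norm_nonneg _)).1 h2⟩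

/-- On the critical line, `ξ(s) ≠ 0` forces `ξ(s) + ξ′(s) ≠ 0`. RH-FREE.
[cite: Suzuki2023b, Prop. 2.2 (proof), p. 6 L52–60] -/
theorem xi_add_deriv_ne_zero_critical {x : ℝ} (hξ : riemannXi (1 / 2 - I * x) ≠ 0) :
    riemannXi (1 / 2 - I * x) + deriv riemannXi (1 / 2 - I * x) ≠ 0 := by
  intro hE
  have h := (norm_riemannXi_le_norm_add_deriv_critical x).1
  rw [hE, norm_zero] at h
  exact hξ (norm_eq_zero.1 (le_antisymm h (norm_nonneg _)))

/-- **`H_n` is analytic at every point of the critical line** (unconditionally): at a non-zero of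
`ξ` by `analyticAt_liModelH` (there `ξ + ξ′ ≠ 0` automatically), at a zero by removability.
RH-FREE. [cite: Suzuki2023b, Prop. 2.2, p. 6 L41–51] -/
theorem analyticAt_liModelH_critical {n : ℕ} (hn : 1 ≤ n) (x : ℝ) :
    AnalyticAt ℂ (liModelH n) (1 / 2 - I * x) := by
  by_cases hξ : riemannXi (1 / 2 - I * x) = 0
  · refine analyticAt_liModelH_of_mem hn ?_
    by_contra h
    exact (riemannXi_ne_zero_iff_not_mem _).2 h hξ
  · exact analyticAt_liModelH hn hξ (xi_add_deriv_ne_zero_critical hξ)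

/-- **[Su23b] Prop. 2.2, real-analyticity: `x ↦ G_n(x)` is real-analytic on all of `ℝ`.**
RH-FREE. [cite: Suzuki2023b, Prop. 2.2, p. 6 L41–51] -/
theorem analyticOnNhd_liModelG_ofReal {n : ℕ} (hn : 1 ≤ n) :
    AnalyticOnNhd ℝ (fun x : ℝ ↦ liModelG n (x : ℂ)) Set.univ := by
  intro x _
  have hA : AnalyticAt ℂ (fun z : ℂ ↦ (1 / 2 : ℂ) - I * z) (x : ℂ) :=
    analyticAt_const.sub (analyticAt_const.mul analyticAt_id)
  have hG : AnalyticAt ℂ (liModelG n) (x : ℂ) := by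
    have hfun : liModelG n = liModelH n ∘ fun z : ℂ ↦ (1 / 2 : ℂ) - I * z := rfl
    rw [hfun]
    exact (analyticAt_liModelH_critical hn x).comp_of_eq hA rfl
  have := (hG.restrictScalars (𝕜 := ℝ)).comp (Complex.ofRealCLM.analyticAt x)
  simpa [Function.comp_def] using this

/-! ## Proposition 2.2 — the bound `H_n(s) ≪_n |s|^{-1}` on the critical line, and `L²(ℝ)` -/

/-- `|1 − (1 − 1/s)ⁿ| ≤ n·3ⁿ/|s|` for `|s| ≥ 1/2` (the crude form of "`H_n(s) ≪_n |s|^{−1} log|s|`"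
that suffices on the critical line). [cite: Suzuki2023b, Prop. 2.2 (proof), p. 6 L62–93] -/
theorem norm_one_sub_one_sub_inv_pow_le' {s : ℂ} (hs : 1 / 2 ≤ ‖s‖) (n : ℕ) :
    ‖1 - (1 - 1 / s) ^ n‖ ≤ n * 3 ^ n / ‖s‖ := by
  have hspos : 0 < ‖s‖ := lt_of_lt_of_le (by norm_num) hs
  have hw : ‖1 - 1 / s‖ ≤ 3 := by
    calc ‖1 - 1 / s‖ ≤ ‖(1 : ℂ)‖ + ‖1 / s‖ := norm_sub_le _ _
      _ ≤ 1 + 2 := by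
          rw [norm_one, norm_div, norm_one]
          gcongr
          rw [div_le_iff₀ hspos]
          linarith
      _ = 3 := by norm_num
  have key : 1 - (1 - 1 / s) ^ n = 1 / s * ∑ i ∈ Finset.range n, (1 - 1 / s) ^ i := by
    have := geom_sum_mul (1 - 1 / s) n
    linear_combination this
  rw [key, norm_mul, norm_div, norm_one, one_div_mul_eq_div]
  gcongr
  calc ‖∑ i ∈ Finset.range n, (1 - 1 / s) ^ i‖
      ≤ ∑ i ∈ Finset.range n, ‖(1 - 1 / s) ^ i‖ := norm_sum_le _ _
    _ ≤ ∑ _i ∈ Finset.range n, (3 : ℝ) ^ n := Finset.sum_le_sum fun i hi ↦ by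
        rw [norm_pow]
        exact (pow_le_pow_left₀ (norm_nonneg _) hw i).trans
          (pow_le_pow_right₀ (by norm_num) (Finset.mem_range.1 hi).le)
    _ = n * 3 ^ n := by simp

/-- The correction polynomial of (1.4),
`Σ_{j=2}^n C(n,j)(−1)^{j−1}s^{−j} Σ_{k=1}^{j−1} c_k s^k`, is `≤ K_P/|s|` for `|s| ≥ 1/2`, with
`K_P = 2ⁿ Σ_j Σ_k C(n,j)|c_k|`. [cite: Suzuki2023b, Prop. 2.2 (proof), p. 6 L62–93] -/
theorem norm_liModel_correction_le (n : ℕ) {s : ℂ} (hs : 1 / 2 ≤ ‖s‖) :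
    ‖∑ j ∈ Icc 2 n, (n.choose j : ℂ) * (-1) ^ (j - 1) / s ^ j *
        ∑ k ∈ Icc 1 (j - 1),
          ((-1) ^ k * (liEta k : ℂ) + (1 - 1 / 2 ^ (k + 1)) * riemannZeta ((k : ℂ) + 1)) * s ^ k‖ ≤
      (2 ^ n * ∑ j ∈ Finset.Icc 2 n, ∑ k ∈ Finset.Icc 1 (j - 1), (n.choose j : ℝ) *
        ‖(-1 : ℂ) ^ k * (liEta k : ℂ) + (1 - 1 / 2 ^ (k + 1)) * riemannZeta ((k : ℂ) + 1)‖) /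
        ‖s‖ := by
  have hspos : 0 < ‖s‖ := lt_of_lt_of_le (by norm_num) hs
  set c : ℕ → ℂ := fun k ↦
    (-1) ^ k * (liEta k : ℂ) + (1 - 1 / 2 ^ (k + 1)) * riemannZeta ((k : ℂ) + 1) with hc
  have hkey : ∀ j ∈ Finset.Icc 2 n, ∀ k ∈ Finset.Icc 1 (j - 1),
      ‖s‖ ^ k / ‖s‖ ^ j ≤ 2 ^ n / ‖s‖ := by
    intro j hj k hk
    obtain ⟨hj2, hjn⟩ := Finset.mem_Icc.1 hj
    obtain ⟨hk1, hkj⟩ := Finset.mem_Icc.1 hk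
    obtain ⟨e, he⟩ : ∃ e, j = k + 1 + e := ⟨j - k - 1, by omega⟩
    have hen : e ≤ n := by omega
    rw [he, pow_add, pow_add, pow_one,
      show ‖s‖ ^ k / (‖s‖ ^ k * ‖s‖ * ‖s‖ ^ e) = (1 / ‖s‖ ^ e) / ‖s‖ by field_simp]
    gcongr
    calc 1 / ‖s‖ ^ e ≤ 2 ^ e := by
          rw [div_le_iff₀ (pow_pos hspos e), ← mul_pow]
          exact one_le_pow₀ (by linarith)
      _ ≤ 2 ^ n := pow_le_pow_right₀ (by norm_num) hen
  calc ‖∑ j ∈ Icc 2 n, (n.choose j : ℂ) * (-1) ^ (j - 1) / s ^ j *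
          ∑ k ∈ Icc 1 (j - 1), c k * s ^ k‖
      ≤ ∑ j ∈ Icc 2 n, ‖(n.choose j : ℂ) * (-1) ^ (j - 1) / s ^ j *
          ∑ k ∈ Icc 1 (j - 1), c k * s ^ k‖ := norm_sum_le _ _
    _ ≤ ∑ j ∈ Icc 2 n, ∑ k ∈ Icc 1 (j - 1), (n.choose j : ℝ) * ‖c k‖ * (2 ^ n / ‖s‖) := by
        refine Finset.sum_le_sum fun j hj ↦ ?_
        rw [norm_mul]
        calc ‖(n.choose j : ℂ) * (-1) ^ (j - 1) / s ^ j‖ * ‖∑ k ∈ Icc 1 (j - 1), c k * s ^ k‖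
            ≤ ‖(n.choose j : ℂ) * (-1) ^ (j - 1) / s ^ j‖ *
                ∑ k ∈ Icc 1 (j - 1), ‖c k * s ^ k‖ := by
              gcongr
              exact norm_sum_le _ _
          _ = ∑ k ∈ Icc 1 (j - 1), (n.choose j : ℝ) * ‖c k‖ * (‖s‖ ^ k / ‖s‖ ^ j) := by
              rw [Finset.mul_sum]
              refine Finset.sum_congr rfl fun k _ ↦ ?_
              rw [norm_mul, norm_div, norm_mul, norm_pow, norm_neg, norm_one, one_pow, mul_one,
                norm_pow, norm_pow, Complex.norm_natCast]
              ring
          _ ≤ ∑ k ∈ Icc 1 (j - 1), (n.choose j : ℝ) * ‖c k‖ * (2 ^ n / ‖s‖) := by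
              refine Finset.sum_le_sum fun k hk ↦ ?_
              exact mul_le_mul_of_nonneg_left (hkey j hj k hk) (by positivity)
    _ = (2 ^ n * ∑ j ∈ Icc 2 n, ∑ k ∈ Icc 1 (j - 1), (n.choose j : ℝ) * ‖c k‖) / ‖s‖ := by
        rw [Finset.mul_sum, Finset.sum_div]
        refine Finset.sum_congr rfl fun j _ ↦ ?_
        rw [Finset.mul_sum, Finset.sum_div]
        refine Finset.sum_congr rfl fun k _ ↦ ?_
        ring

/-- `Re(½ − ix) = ½`, so `|½ − ix| ≥ ½`. [folklore] -/
private theorem half_le_norm_critical (x : ℝ) : 1 / 2 ≤ ‖(1 / 2 : ℂ) - I * x‖ := by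
  have h := Complex.abs_re_le_norm ((1 / 2 : ℂ) - I * x)
  have hre : ((1 / 2 : ℂ) - I * x).re = 1 / 2 := by simp
  rw [hre, abs_of_pos (by norm_num : (0 : ℝ) < 1 / 2)] at h
  exact h

/-- **The pointwise bound on the critical line**: for `n ≥ 1` there is `K = K(n) ≥ 0` with
`|H_n(½ − ix)| ≤ K/|½ − ix|` at every real `x` with `ξ(½ − ix) ≠ 0` (the printed
"`H_n(s) ≪_n |s|^{−1} log|s|` as `|s| → ∞` on `Re(s) = ½`", in a form without the logarithm:
on the line `|ξ/(ξ+ξ′)| ≤ 1`, `|ξ′/(ξ+ξ′)| ≤ 1`, `|s − 1| = |s|`). RH-FREE.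
[cite: Suzuki2023b, Prop. 2.2 (proof), p. 6 L52–93] -/
theorem norm_liModelH_critical_le {n : ℕ} (hn : 1 ≤ n) : ∃ K : ℝ, 0 ≤ K ∧ ∀ x : ℝ,
    riemannXi (1 / 2 - I * x) ≠ 0 →
      ‖liModelH n (1 / 2 - I * x)‖ ≤ K / ‖(1 / 2 : ℂ) - I * x‖ := by
  classical
  set B : ℂ := deriv riemannXi 0 / riemannXi 0 with hB
  set KP : ℝ := 2 ^ n * ∑ j ∈ Icc 2 n, ∑ k ∈ Icc 1 (j - 1), (n.choose j : ℝ) *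
      ‖(-1 : ℂ) ^ k * (liEta k : ℂ) + (1 - 1 / 2 ^ (k + 1)) * riemannZeta ((k : ℂ) + 1)‖
    with hKP
  have hKP0 : 0 ≤ KP := by positivity
  refine ⟨1 + n * 3 ^ n * (3 + ‖B + 1‖) + KP, by positivity, fun x hξ ↦ ?_⟩
  have hs_half : 1 / 2 ≤ ‖(1 / 2 : ℂ) - I * x‖ := half_le_norm_critical x
  set s : ℂ := 1 / 2 - I * x with hs_def
  have hsre : s.re = 1 / 2 := by simp [hs_def]
  have hspos : 0 < ‖s‖ := lt_of_lt_of_le (by norm_num) hs_half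
  have hs0 : s ≠ 0 := norm_pos_iff.mp hspos
  have hs1 : s ≠ 1 := fun h ↦ by
    have := congrArg Complex.re h
    rw [hsre, Complex.one_re] at this
    norm_num at this
  have hE : riemannXi s + deriv riemannXi s ≠ 0 := xi_add_deriv_ne_zero_critical hξ
  have hnorm1 : ‖s - 1‖ = ‖s‖ := by
    have : s - 1 = -conj s := by
      apply Complex.ext
      · simp [hs_def]; norm_num
      · simp [hs_def]
    rw [this, norm_neg, Complex.norm_conj]
  obtain ⟨hq, hq'⟩ := norm_riemannXi_le_norm_add_deriv_critical x
  set ξs : ℂ := riemannXi s with hξs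
  set ξ's : ℂ := deriv riemannXi s with hξ's
  have hEpos : 0 < ‖ξs + ξ's‖ := norm_pos_iff.mpr hE
  have hq1 : ‖ξs / (ξs + ξ's)‖ ≤ 1 := by rw [norm_div, div_le_one hEpos]; exact hq
  have hq'1 : ‖ξ's / (ξs + ξ's)‖ ≤ 1 := by rw [norm_div, div_le_one hEpos]; exact hq'
  set u : ℂ := 1 / (s - 1) with hu_def
  have hu : ‖u‖ = 1 / ‖s‖ := by rw [hu_def, norm_div, norm_one, hnorm1]
  set b : ℂ := 1 - (1 - 1 / s) ^ n with hb_def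
  have hb : ‖b‖ ≤ n * 3 ^ n / ‖s‖ := norm_one_sub_one_sub_inv_pow_le' hs_half n
  set P : ℂ := ∑ j ∈ Icc 2 n, (n.choose j : ℂ) * (-1) ^ (j - 1) / s ^ j *
      ∑ k ∈ Icc 1 (j - 1),
        ((-1) ^ k * (liEta k : ℂ) + (1 - 1 / 2 ^ (k + 1)) * riemannZeta ((k : ℂ) + 1)) * s ^ k
    with hP_def
  have hP : ‖P‖ ≤ KP / ‖s‖ := norm_liModel_correction_le n hs_half
  rw [liModelH_eq_formula_of_ne n hs0 hs1 hξ hE]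
  have hform : liModelHFormula n s =
      ξs / (ξs + ξ's) * (u + b * (ξ's / ξs - u - B - 1) - P) := rfl
  have hqq : ξs / (ξs + ξ's) * (ξ's / ξs) = ξ's / (ξs + ξ's) := by
    field_simp
  have hexp : liModelHFormula n s =
      ξs / (ξs + ξ's) * u + b * (ξ's / (ξs + ξ's) - ξs / (ξs + ξ's) * (u + B + 1)) -
        ξs / (ξs + ξ's) * P := by
    rw [hform, ← hqq]; ring
  rw [hexp]
  have h1 : ‖ξs / (ξs + ξ's) * u‖ ≤ 1 / ‖s‖ := by
    rw [norm_mul, hu]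
    exact mul_le_of_le_one_left (by positivity) hq1
  have h2 : ‖b * (ξ's / (ξs + ξ's) - ξs / (ξs + ξ's) * (u + B + 1))‖ ≤
      n * 3 ^ n / ‖s‖ * (1 + (1 / ‖s‖ + ‖B + 1‖)) := by
    rw [norm_mul]
    refine mul_le_mul hb ?_ (norm_nonneg _) (by positivity)
    calc ‖ξ's / (ξs + ξ's) - ξs / (ξs + ξ's) * (u + B + 1)‖
        ≤ ‖ξ's / (ξs + ξ's)‖ + ‖ξs / (ξs + ξ's) * (u + B + 1)‖ := norm_sub_le _ _
      _ ≤ 1 + 1 * (1 / ‖s‖ + ‖B + 1‖) := by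
          refine add_le_add hq'1 ?_
          rw [norm_mul]
          refine mul_le_mul hq1 ?_ (norm_nonneg _) zero_le_one
          calc ‖u + B + 1‖ = ‖u + (B + 1)‖ := by rw [add_assoc]
            _ ≤ ‖u‖ + ‖B + 1‖ := norm_add_le _ _
            _ = 1 / ‖s‖ + ‖B + 1‖ := by rw [hu]
      _ = 1 + (1 / ‖s‖ + ‖B + 1‖) := by ring
  have h3 : ‖ξs / (ξs + ξ's) * P‖ ≤ KP / ‖s‖ := by
    rw [norm_mul]
    exact (mul_le_of_le_one_left (norm_nonneg _) hq1).trans hP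
  have h2s : 1 / ‖s‖ ≤ 2 := by
    rw [div_le_iff₀ hspos]
    linarith
  calc ‖ξs / (ξs + ξ's) * u + b * (ξ's / (ξs + ξ's) - ξs / (ξs + ξ's) * (u + B + 1)) -
          ξs / (ξs + ξ's) * P‖
      ≤ ‖ξs / (ξs + ξ's) * u + b * (ξ's / (ξs + ξ's) - ξs / (ξs + ξ's) * (u + B + 1))‖ +
          ‖ξs / (ξs + ξ's) * P‖ := norm_sub_le _ _
    _ ≤ ‖ξs / (ξs + ξ's) * u‖ + ‖b * (ξ's / (ξs + ξ's) - ξs / (ξs + ξ's) * (u + B + 1))‖ +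
          ‖ξs / (ξs + ξ's) * P‖ := by
        gcongr
        exact norm_add_le _ _
    _ ≤ 1 / ‖s‖ + n * 3 ^ n / ‖s‖ * (1 + (1 / ‖s‖ + ‖B + 1‖)) + KP / ‖s‖ :=
        add_le_add (add_le_add h1 h2) h3
    _ = (1 + n * 3 ^ n * (1 + (1 / ‖s‖ + ‖B + 1‖)) + KP) / ‖s‖ := by
        field_simp
    _ ≤ (1 + n * 3 ^ n * (3 + ‖B + 1‖) + KP) / ‖s‖ := by
        apply div_le_div_of_nonneg_right _ hspos.le
        have : (n : ℝ) * 3 ^ n * (1 + (1 / ‖s‖ + ‖B + 1‖)) ≤ n * 3 ^ n * (3 + ‖B + 1‖) :=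
          mul_le_mul_of_nonneg_left (by linarith) (by positivity)
        linarith

/-- **[Su23b] Proposition 2.2 (discharge of `Suzuki2023b_prop22`)**: for every `n ≥ 1` the
restriction of `G_n` to the real line is bounded, real-analytic, and in `L²(ℝ)` —
UNCONDITIONALLY. Proof: real-analyticity from `analyticAt_liModelH_critical` (Prop. 2.1 and
removability); the bound `|G_n(x)| ≤ K/|½ − ix|` at the non-zeros of `ξ(½ − ix)`
(`norm_liModelH_critical_le`) extends to every real `x` by continuity (the zeros are isolated),
giving boundedness (`|½ − ix| ≥ ½`) and square-integrability (`K²/(¼ + x²)` is integrable).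
RH-FREE. [cite: Suzuki2023b, Prop. 2.2, p. 6 L41–93] -/
theorem Suzuki2023b_prop22_holds : Suzuki2023b_prop22 := by
  intro n hn
  obtain ⟨K, hK0, hK⟩ := norm_liModelH_critical_le hn
  have hGan := analyticOnNhd_liModelG_ofReal hn
  have hGcont : Continuous fun x : ℝ ↦ liModelG n (x : ℂ) :=
    continuousOn_univ.1 hGan.continuousOn
  have haff : Continuous fun x : ℝ ↦ (1 / 2 : ℂ) - I * x :=
    continuous_const.sub (continuous_const.mul Complex.continuous_ofReal)
  have hgcont : Continuous fun x : ℝ ↦ K / ‖(1 / 2 : ℂ) - I * x‖ :=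
    continuous_const.div (continuous_norm.comp haff) fun x ↦
      (lt_of_lt_of_le (by norm_num) (half_le_norm_critical x)).ne'
  -- the bound at every real point, by continuity across the (isolated) critical zeros
  have hbound : ∀ x : ℝ, ‖liModelG n (x : ℂ)‖ ≤ K / ‖(1 / 2 : ℂ) - I * x‖ := by
    intro x₀
    have hmap : Tendsto (fun x : ℝ ↦ (1 / 2 : ℂ) - I * x) (𝓝[≠] x₀)
        (𝓝[≠] ((1 / 2 : ℂ) - I * x₀)) := by
      refine tendsto_nhdsWithin_of_tendsto_nhds_of_eventually_within _
        ((haff.tendsto x₀).mono_left nhdsWithin_le_nhds) ?_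
      filter_upwards [self_mem_nhdsWithin] with x hx
      intro h
      apply hx
      have := congrArg Complex.im h
      simpa using this
    have hev : ∀ᶠ x : ℝ in 𝓝[≠] x₀, ‖liModelG n (x : ℂ)‖ ≤ K / ‖(1 / 2 : ℂ) - I * x‖ := by
      filter_upwards [hmap.eventually (eventually_not_mem_nontrivialZeros _)] with x hx
      exact hK x ((riemannXi_ne_zero_iff_not_mem _).2 hx)
    exact le_of_tendsto_of_tendsto
      (((continuous_norm.comp hGcont).tendsto x₀).mono_left nhdsWithin_le_nhds)
      ((hgcont.tendsto x₀).mono_left nhdsWithin_le_nhds) hev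
  refine ⟨⟨2 * K, fun x ↦ (hbound x).trans ?_⟩, hGan, ?_⟩
  · calc K / ‖(1 / 2 : ℂ) - I * x‖ ≤ K / (1 / 2) :=
          div_le_div_of_nonneg_left hK0 (by norm_num) (half_le_norm_critical x)
      _ = 2 * K := by ring
  · have hgL2 : MemLp (fun x : ℝ ↦ K / ‖(1 / 2 : ℂ) - I * x‖) 2 volume := by
      rw [memLp_two_iff_integrable_sq hgcont.aestronglyMeasurable]
      refine (integrable_inv_one_add_sq.const_mul (4 * K ^ 2)).mono'
        (hgcont.pow 2).aestronglyMeasurable (Filter.Eventually.of_forall fun x ↦ ?_)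
      rw [Real.norm_of_nonneg (by positivity)]
      have hns : ‖(1 / 2 : ℂ) - I * x‖ ^ 2 = 1 / 4 + x ^ 2 := by
        rw [Complex.sq_norm, Complex.normSq_apply]
        simp
        ring
      rw [div_pow, hns]
      calc K ^ 2 / (1 / 4 + x ^ 2) = 4 * K ^ 2 / (1 + 4 * x ^ 2) := by
            field_simp
        _ ≤ 4 * K ^ 2 / (1 + x ^ 2) :=
            div_le_div_of_nonneg_left (by positivity) (by positivity) (by nlinarith)
        _ = 4 * K ^ 2 * (1 + x ^ 2)⁻¹ := div_eq_mul_inv _ _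
    refine hgL2.of_le hGcont.aestronglyMeasurable (Filter.Eventually.of_forall fun x ↦ ?_)
    rw [Real.norm_of_nonneg (by positivity)]
    exact hbound x

/-! ## Proposition 2.3 (1), (3), (5) -/

/-- `ξ(1) + ξ′(1) = ½ + β/4` (`ξ(1) = ½`, `ξ′/ξ(1) = β/2` with `β = nicolasBeta`). RH-FREE.
[cite: Suzuki2023b, Prop. 2.3 (3) ("s = 0 and s = 1 are not poles of H_n(s)"), p. 6 L112–114] -/
theorem xi_add_deriv_one :
    riemannXi 1 + deriv riemannXi 1 = 1 / 2 + (nicolasBeta : ℂ) / 4 := by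
  have h := logDeriv_riemannXi_one
  rw [logDeriv_apply, riemannXi_one, div_eq_iff (by norm_num)] at h
  rw [riemannXi_one, h]
  ring

/-- `ξ(0) + ξ′(0) = ½ − β/4` (`ξ′(0) = −ξ′(1)` by the functional equation). RH-FREE.
[cite: Suzuki2023b, Prop. 2.3 (3), p. 6 L112–114] -/
theorem xi_add_deriv_zero :
    riemannXi 0 + deriv riemannXi 0 = 1 / 2 - (nicolasBeta : ℂ) / 4 := by
  have h0 : deriv riemannXi 0 = -deriv riemannXi 1 := by
    simpa using deriv_riemannXi_one_sub 1
  have h := logDeriv_riemannXi_one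
  rw [logDeriv_apply, riemannXi_one, div_eq_iff (by norm_num)] at h
  rw [riemannXi_zero, h0, h]
  ring

/-- `ξ(1) + ξ′(1) ≠ 0` (it equals `½ + β/4 > 0`). RH-FREE.
[cite: Suzuki2023b, Prop. 2.3 (3), p. 6 L112–114] -/
theorem xi_add_deriv_one_ne_zero : riemannXi 1 + deriv riemannXi 1 ≠ 0 := by
  rw [xi_add_deriv_one]
  intro h0
  have := congrArg Complex.re h0
  simp at this
  linarith [nicolasBeta_gt]

/-- `ξ(0) + ξ′(0) ≠ 0` (it equals `½ − β/4`, and `β < 0.0474`). RH-FREE.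
[cite: Suzuki2023b, Prop. 2.3 (3), p. 6 L112–114] -/
theorem xi_add_deriv_zero_ne_zero : riemannXi 0 + deriv riemannXi 0 ≠ 0 := by
  rw [xi_add_deriv_zero]
  intro h0
  have := congrArg Complex.re h0
  simp at this
  linarith [nicolasBeta_lt']

/-- `ξ + ξ′` is an entire function, not identically zero (`ξ(1)+ξ′(1) ≠ 0`), so its zeros are
isolated: every point has a punctured neighbourhood on which `ξ + ξ′ ≠ 0` ("a discrete subset
of `ℂ`", p. 6 L108–109). RH-FREE. [cite: Suzuki2023b, Prop. 2.3 (proof), p. 6 L108–109] -/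
theorem eventually_xi_add_deriv_ne_zero' (c : ℂ) :
    ∀ᶠ w in 𝓝[≠] c, riemannXi w + deriv riemannXi w ≠ 0 := by
  have hξ'd : Differentiable ℂ (deriv riemannXi) :=
    (differentiable_riemannXi.contDiff (n := 2)).differentiable_deriv_two
  have hEan : AnalyticOnNhd ℂ (fun w ↦ riemannXi w + deriv riemannXi w) Set.univ :=
    fun w _ ↦ (differentiable_riemannXi.analyticAt w).add (hξ'd.analyticAt w)
  rcases (hEan c (Set.mem_univ c)).eventually_eq_zero_or_eventually_ne_zero with h | h
  · exfalso
    have hzero := hEan.eqOn_zero_of_preconnected_of_eventuallyEq_zero isPreconnected_univ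
      (Set.mem_univ c) h
    exact xi_add_deriv_one_ne_zero (hzero (Set.mem_univ (1 : ℂ)))
  · exact h

/-- **Conjugation symmetry of `M_n`**: `M_n(s̄) = −conj M_n(s)` off `𝒵` (`ρ ↦ ρ̄` permutes the
zeros with their multiplicities; the prefactor `−i` changes sign). RH-FREE.
[cite: Suzuki2023b, Prop. 2.3 (1), (5) (proof: "real valued on the real line"), p. 6 L103–104, L125–126] -/
theorem liModelM_conj (n : ℕ) (s : ℂ) : liModelM n (conj s) = -conj (liModelM n s) := by
  classical
  set c : riemannZetaNontrivialZeros ≃ riemannZetaNontrivialZeros :=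
    involutive_nontrivialZeros_conj.toPerm _ with hc
  set F : riemannZetaNontrivialZeros → ℂ := fun ρ ↦
    (riemannZetaZeroOrder (ρ : ℂ) : ℂ) * (1 - (1 - 1 / (ρ : ℂ)) ^ n) / (s - ρ) with hF
  have hFc : ∀ ρ, (riemannZetaZeroOrder ((c ρ : riemannZetaNontrivialZeros) : ℂ) : ℂ) *
      (1 - (1 - 1 / ((c ρ : riemannZetaNontrivialZeros) : ℂ)) ^ n) / (conj s - (c ρ : ℂ)) =
        conj (F ρ) := by
    intro ρ
    simp only [hF, hc, Function.Involutive.coe_toPerm]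
    rw [riemannZetaZeroOrder_conj_holds, map_div₀, map_mul, map_intCast, map_sub]
    simp only [map_sub, map_one, map_pow, map_div₀]
  unfold liModelM
  rw [map_mul, map_neg, Complex.conj_I, neg_neg, Complex.conj_tsum,
    ← Equiv.tsum_eq c (fun ρ : riemannZetaNontrivialZeros ↦
      (riemannZetaZeroOrder (ρ : ℂ) : ℂ) * (1 - (1 - 1 / (ρ : ℂ)) ^ n) / (conj s - ρ))]
  rw [tsum_congr hFc]
  ring

/-- **Conjugation symmetry of `H_n` at the regular points**: at every `s` with `ξ(s) ≠ 0`,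
`ξ(s)+ξ′(s) ≠ 0`, `H_n(s̄) = conj H_n(s)` (`ξ(s̄) = conj ξ(s)`, `ξ′(s̄) = conj ξ′(s)`,
`M_n(s̄) = −conj M_n(s)`). RH-FREE. [cite: Suzuki2023b, Prop. 2.3 (1), (5), p. 6 L103–104, L125–126] -/
theorem liModelH_conj {n : ℕ} (hn : 1 ≤ n) {s : ℂ} (hξ : riemannXi s ≠ 0)
    (hE : riemannXi s + deriv riemannXi s ≠ 0) :
    liModelH n (conj s) = conj (liModelH n s) := by
  have hξc : riemannXi (conj s) = conj (riemannXi s) := riemannXi_conj_holds s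
  have hξ'c : deriv riemannXi (conj s) = conj (deriv riemannXi s) := deriv_riemannXi_conj s
  have hξ' : riemannXi (conj s) ≠ 0 := by
    rw [hξc]; exact (map_ne_zero _).2 hξ
  have hE' : riemannXi (conj s) + deriv riemannXi (conj s) ≠ 0 := by
    rw [hξc, hξ'c, ← map_add]; exact (map_ne_zero _).2 hE
  rw [(Suzuki2023b_prop21_holds n hn).1 s hξ hE, (Suzuki2023b_prop21_holds n hn).1 _ hξ' hE',
    hξc, hξ'c, liModelM_conj]
  simp only [map_mul, map_div₀, map_add, Complex.conj_I]
  ring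

/-- **[Su23b] Proposition 2.3 (3) (discharge of `Suzuki2023b_prop23_3`)**: `H_n` is analytic at
every `s` with `ξ(s)+ξ′(s) ≠ 0` or `ξ(s) = 0`, and at `s = 0` and `s = 1`
(`ξ(0)+ξ′(0) = ½ − β/4 ≠ 0`, `ξ(1)+ξ′(1) = ½ + β/4 ≠ 0`). RH-FREE.
[cite: Suzuki2023b, Prop. 2.3 (3), p. 6 L112–114] -/
theorem Suzuki2023b_prop23_3_holds : Suzuki2023b_prop23_3 := by
  intro n hn
  have hzero : ∀ s : ℂ, riemannXi s = 0 → AnalyticAt ℂ (liModelH n) s := fun s hs ↦ by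
    refine analyticAt_liModelH_of_mem hn ?_
    by_contra h
    exact (riemannXi_ne_zero_iff_not_mem _).2 h hs
  refine ⟨fun s hs ↦ ?_, ?_, ?_⟩
  · by_cases hξ : riemannXi s = 0
    · exact hzero s hξ
    · rcases hs with hE | h0
      · exact analyticAt_liModelH hn hξ hE
      · exact (hξ h0).elim
  · exact analyticAt_liModelH hn (by rw [riemannXi_zero]; norm_num) xi_add_deriv_zero_ne_zero
  · exact analyticAt_liModelH hn (by rw [riemannXi_one]; norm_num) xi_add_deriv_one_ne_zero

/-- **[Su23b] Proposition 2.3 (5) (discharge of `Suzuki2023b_prop23_5`)**: the zero set of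
`ξ + ξ′` and the pole set of `H_n` are closed under complex conjugation. The first from
`ξ(s̄) = conj ξ(s)`, `ξ′(s̄) = conj ξ′(s)`; the second because `|H_n(w̄)| = |H_n(w)|` on a punctured
neighbourhood of `l̄` (where `H_n = iξM_n/(ξ+ξ′)`, the zeros of `ξ` and of `ξ+ξ′` being isolated)
and `w ↦ w̄` maps punctured neighbourhoods of `l̄` onto those of `l`. RH-FREE.
[cite: Suzuki2023b, Prop. 2.3 (5), p. 6 L125–126] -/
theorem Suzuki2023b_prop23_5_holds : Suzuki2023b_prop23_5 := by
  refine ⟨fun s hs ↦ ?_, fun n hn l hl ↦ ?_⟩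
  · rw [riemannXi_conj_holds s, deriv_riemannXi_conj s, ← map_add, hs, map_zero]
  · -- `conj` maps `𝓝[≠] (conj l)` to `𝓝[≠] l`
    have hconj : Tendsto (fun w : ℂ ↦ conj w) (𝓝[≠] (conj l)) (𝓝[≠] l) := by
      refine tendsto_nhdsWithin_of_tendsto_nhds_of_eventually_within _ ?_ ?_
      · have := (Complex.continuous_conj.tendsto (conj l)).mono_left
          (nhdsWithin_le_nhds (s := {conj l}ᶜ))
        simpa using this
      · filter_upwards [self_mem_nhdsWithin] with w hw
        intro h
        apply hw
        have := congrArg conj h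
        simpa using this
    have h1 : Tendsto (fun w ↦ ‖liModelH n (conj w)‖) (𝓝[≠] (conj l)) atTop := hl.comp hconj
    -- on a punctured neighbourhood of `conj l`: no zeros of `ξ` and of `ξ + ξ′`
    have hev : (fun w ↦ ‖liModelH n (conj w)‖) =ᶠ[𝓝[≠] (conj l)] fun w ↦ ‖liModelH n w‖ := by
      filter_upwards [eventually_not_mem_nontrivialZeros (conj l),
        eventually_xi_add_deriv_ne_zero' (conj l)] with w hwZ hwE
      rw [liModelH_conj hn ((riemannXi_ne_zero_iff_not_mem w).2 hwZ) hwE, Complex.norm_conj]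
    exact Filter.Tendsto.congr' hev h1

/-- **[Su23b] Proposition 2.3 (1) (discharge of `Suzuki2023b_prop23_1`)**: `H_n` is meromorphic
on `ℂ` and real-valued on the real line (off the real zeros of `ξ + ξ′`). Meromorphy: analytic at
the points of `𝒵` (removable) and where `ξ+ξ′ ≠ 0`; at a zero `l ∉ 𝒵` of `ξ+ξ′`, `H_n` agrees with
the meromorphic `iξM_n/(ξ+ξ′)` on a punctured neighbourhood. Reality: the real line carries no
zero of `ξ`, and `H_n(x̄) = conj H_n(x)`. RH-FREE. [cite: Suzuki2023b, Prop. 2.3 (1), p. 6 L103–104, L128–130] -/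
theorem Suzuki2023b_prop23_1_holds : Suzuki2023b_prop23_1 := by
  intro n hn
  have hξ'd : Differentiable ℂ (deriv riemannXi) :=
    (differentiable_riemannXi.contDiff (n := 2)).differentiable_deriv_two
  refine ⟨fun s _ ↦ ?_, fun x hE ↦ ?_⟩
  · by_cases hξ : riemannXi s = 0
    · refine (analyticAt_liModelH_of_mem hn ?_).meromorphicAt
      by_contra h
      exact (riemannXi_ne_zero_iff_not_mem _).2 h hξ
    by_cases hE : riemannXi s + deriv riemannXi s = 0
    · -- a (possible) pole: `H_n = iξM_n/(ξ+ξ′)` on a punctured neighbourhood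
      have hs : s ∉ riemannZetaNontrivialZeros := (riemannXi_ne_zero_iff_not_mem s).1 hξ
      have hR : MeromorphicAt (fun w ↦ I * riemannXi w * liModelM n w /
          (riemannXi w + deriv riemannXi w)) s := by
        have hnum : AnalyticAt ℂ (fun w ↦ I * riemannXi w * liModelM n w) s := by
          refine (analyticAt_const.mul (differentiable_riemannXi.analyticAt s)).mul ?_
          rw [Complex.analyticAt_iff_eventually_differentiableAt]
          obtain ⟨δ, hδ, -, hsep⟩ := exists_pos_le_norm_sub_of_nontrivialZeros s
          filter_upwards [Metric.ball_mem_nhds s hδ] with w hw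
          refine differentiableAt_liModelM hn fun hwZ ↦ ?_
          rcases eq_or_ne w s with rfl | hne
          · exact hs hwZ
          · have h2 := hsep w hwZ hne
            rw [Metric.mem_ball, dist_eq_norm] at hw
            linarith
        have hden : AnalyticAt ℂ (fun w ↦ riemannXi w + deriv riemannXi w) s :=
          (differentiable_riemannXi.analyticAt s).add (hξ'd.analyticAt s)
        exact hnum.meromorphicAt.fun_div hden.meromorphicAt
      refine hR.congr ?_
      filter_upwards [(differentiable_riemannXi.continuous.continuousAt.eventually_ne hξ).filter_mono
        nhdsWithin_le_nhds, eventually_xi_add_deriv_ne_zero' s] with w hwξ hwE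
      rw [(Suzuki2023b_prop21_holds n hn).1 w hwξ hwE]
      ring
    · exact (analyticAt_liModelH hn hξ hE).meromorphicAt
  · -- reality on the real line
    have hxZ : (x : ℂ) ∉ riemannZetaNontrivialZeros := fun h ↦ by
      have := FordL33.fourteen_lt_abs_im ⟨x, h⟩
      simp at this
      linarith
    have hξ : riemannXi x ≠ 0 := (riemannXi_ne_zero_iff_not_mem _).2 hxZ
    have h := liModelH_conj hn hξ hE
    rw [Complex.conj_ofReal] at h
    exact Complex.conj_eq_iff_im.1 h.symm

/-! ## The Mellin transform of `g_n` ([BoLa99, Lemma 2]) -/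

/-- `𝟙_{(0,1]}(t)(log t)^k = O(t^{−b})` as `t → 0⁺`, for every `b > 0`. [folklore] -/
private theorem isBigO_indicator_log_pow (k : ℕ) {b : ℝ} (hb : 0 < b) :
    (Set.indicator (Set.Ioc 0 1) (fun t : ℝ ↦ ((Real.log t : ℂ)) ^ k)) =O[𝓝[>] 0]
      (· ^ (-b)) := by
  induction k generalizing b with
  | zero =>
    refine Asymptotics.IsBigO.of_bound 1 ?_
    filter_upwards [Ioo_mem_nhdsGT (zero_lt_one' ℝ)] with t ht
    have h1 : (1 : ℝ) ≤ t ^ (-b) :=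
      Real.one_le_rpow_of_pos_of_le_one_of_nonpos ht.1 ht.2.le (by linarith)
    rw [Real.norm_of_nonneg (by linarith), one_mul]
    refine le_trans ?_ h1
    by_cases hmem : t ∈ Set.Ioc (0 : ℝ) 1
    · rw [Set.indicator_of_mem hmem]; simp
    · rw [Set.indicator_of_notMem hmem]; simp
  | succ k ih =>
    have h := isBigO_rpow_zero_log_smul (a := b / 2) (b := b) (by linarith) (ih (by linarith))
    refine h.congr' (Filter.Eventually.of_forall fun t ↦ ?_) Filter.EventuallyEq.rfl
    show Real.log t • Set.indicator (Set.Ioc 0 1) (fun t : ℝ ↦ ((Real.log t : ℂ)) ^ k) t = _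
    by_cases hmem : t ∈ Set.Ioc (0 : ℝ) 1
    · rw [Set.indicator_of_mem hmem, Set.indicator_of_mem hmem, Complex.real_smul, pow_succ']
    · rw [Set.indicator_of_notMem hmem, Set.indicator_of_notMem hmem, smul_zero]

/-- **The Mellin transform of `𝟙_{(0,1]}(log t)^k` is `(−1)^k k!/s^{k+1}` on `Re s > 0`**
(`∫₀¹ (log x)^k x^{s−1} dx = (−1)^k k! s^{−k−1}`), by induction on `k`: the case `k = 0` is
`hasMellin_one_Ioc`, and the Mellin transform of `log·f` is the derivative of that of `f`
(`mellin_hasDerivAt_of_isBigO_rpow`).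
[cite: Suzuki2023b, proof of Prop. 2.1, p. 4 L88–93 (= BombieriLagarias1999, Lemma 2)] -/
theorem hasMellin_indicator_log_pow (k : ℕ) {s : ℂ} (hs : 0 < s.re) :
    HasMellin (Set.indicator (Set.Ioc 0 1) (fun t : ℝ ↦ ((Real.log t : ℂ)) ^ k)) s
      ((-1) ^ k * (k.factorial : ℂ) / s ^ (k + 1)) := by
  induction k generalizing s with
  | zero =>
    have h := hasMellin_one_Ioc hs
    have hfun : (Set.indicator (Set.Ioc 0 1) (fun t : ℝ ↦ ((Real.log t : ℂ)) ^ 0)) =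
        Set.indicator (Set.Ioc 0 1) (fun _ : ℝ ↦ (1 : ℂ)) := by
      simp only [pow_zero]
    rw [hfun]
    simpa using h
  | succ k ih =>
    set f : ℝ → ℂ := Set.indicator (Set.Ioc 0 1) (fun t : ℝ ↦ ((Real.log t : ℂ)) ^ k) with hf
    -- hypotheses of the differentiation lemma
    have hfc : LocallyIntegrableOn f (Set.Ioi 0) := by
      rw [locallyIntegrableOn_iff isOpen_Ioi.isLocallyClosed]
      intro K hK hKc
      have hcont : ContinuousOn (fun t : ℝ ↦ ((Real.log t : ℂ)) ^ k) K :=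
        ((Complex.continuous_ofReal.comp_continuousOn
          (Real.continuousOn_log.mono fun t ht ↦ (hK ht).ne')).pow k)
      exact (hcont.integrableOn_compact hKc).indicator measurableSet_Ioc
    have hf_top : f =O[atTop] (· ^ (-(s.re + 1))) := by
      refine (Asymptotics.isBigO_zero _ _).congr' ?_ Filter.EventuallyEq.rfl
      filter_upwards [eventually_gt_atTop 1] with t ht
      exact (Set.indicator_of_notMem (fun h ↦ absurd h.2 (not_le.2 ht)) _).symm
    have hf_bot : f =O[𝓝[>] 0] (· ^ (-(s.re / 2))) :=
      isBigO_indicator_log_pow k (by linarith)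
    obtain ⟨hconv, hder⟩ := mellin_hasDerivAt_of_isBigO_rpow hfc hf_top (by linarith) hf_bot
      (by linarith)
    have hfun : (fun t : ℝ ↦ Real.log t • f t) =
        Set.indicator (Set.Ioc 0 1) (fun t : ℝ ↦ ((Real.log t : ℂ)) ^ (k + 1)) := by
      funext t
      by_cases hmem : t ∈ Set.Ioc (0 : ℝ) 1
      · rw [hf, Set.indicator_of_mem hmem, Set.indicator_of_mem hmem, Complex.real_smul, pow_succ']
      · rw [hf, Set.indicator_of_notMem hmem, Set.indicator_of_notMem hmem, smul_zero]
    rw [hfun] at hconv hder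
    -- `mellin f = (−1)^k k!/z^{k+1}` near `s`
    have hopen : IsOpen {z : ℂ | 0 < z.re} := isOpen_lt continuous_const Complex.continuous_re
    have hg : mellin f =ᶠ[𝓝 s] fun z ↦ (-1) ^ k * (k.factorial : ℂ) / z ^ (k + 1) := by
      filter_upwards [hopen.mem_nhds hs] with z hz
      exact (ih hz).2
    have hder' := hder.congr_of_eventuallyEq hg.symm
    -- the derivative of the closed form
    have hs0 : s ≠ 0 := fun h ↦ by rw [h, Complex.zero_re] at hs; exact lt_irrefl _ hs
    have hder2 : HasDerivAt (fun z : ℂ ↦ (-1) ^ k * (k.factorial : ℂ) / z ^ (k + 1))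
        ((-1) ^ (k + 1) * ((k + 1).factorial : ℂ) / s ^ (k + 1 + 1)) s := by
      have h1 : HasDerivAt (fun z : ℂ ↦ z ^ (k + 1)) (((k + 1 : ℕ) : ℂ) * s ^ k) s := by
        simpa using hasDerivAt_pow (k + 1) s
      have h2 := (hasDerivAt_const s ((-1) ^ k * (k.factorial : ℂ))).div h1 (pow_ne_zero _ hs0)
      refine h2.congr_deriv ?_
      field_simp
      push_cast [Nat.factorial_succ]
      ring
    exact ⟨hconv, hder'.unique hder2⟩

/-- `Σ_{j=1}^n C(n,j)(−1)^{j−1}x^j = 1 − (1−x)ⁿ`. [folklore] -/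
private theorem su23b_binom₃ (x : ℂ) (n : ℕ) :
    ∑ j ∈ Finset.Icc 1 n, (n.choose j : ℂ) * (-1) ^ (j - 1) * x ^ j = 1 - (1 - x) ^ n := by
  rw [← su23b_binom₂ x n, ← Finset.Ico_add_one_right_eq_Icc, Finset.sum_Ico_eq_sum_range]
  simp only [Nat.add_sub_cancel]
  refine Finset.sum_congr rfl fun i _ ↦ ?_
  rw [add_comm 1 i, Nat.add_sub_cancel]

/-- **The Mellin transform of `g_n` (discharge of `Suzuki2023b_mellin_testFun`)**: for `n ≥ 1` and
`Re ρ > 0`, `∫₀^∞ g_n(x) x^{ρ−1} dx = 1 − (1 − 1/ρ)ⁿ`. From `∫₀¹ (log x)^{j−1} x^{ρ−1} dx =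
(−1)^{j−1}(j−1)!/ρ^j` (`hasMellin_indicator_log_pow`) and the binomial theorem; the value of
`g_n` at `x = 1` is immaterial. RH-FREE.
[cite: Suzuki2023b, §4.2, p. 10 L95–97; proof of Prop. 2.1, p. 4 L88–93 (= BombieriLagarias1999, Lemma 2)] -/
theorem Suzuki2023b_mellin_testFun_holds : Suzuki2023b_mellin_testFun := by
  intro n hn ρ hρ
  classical
  set f : ℕ → ℝ → ℂ := fun k ↦ Set.indicator (Set.Ioc 0 1) (fun t : ℝ ↦ ((Real.log t : ℂ)) ^ k)
    with hf
  have hM : ∀ k, HasMellin (f k) ρ ((-1) ^ k * (k.factorial : ℂ) / ρ ^ (k + 1)) := fun k ↦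
    hasMellin_indicator_log_pow k hρ
  have hρ0 : ρ ≠ 0 := fun h ↦ by rw [h, Complex.zero_re] at hρ; exact lt_irrefl _ hρ
  -- the integrand, almost everywhere on `(0, ∞)`
  have hae : ∀ᵐ x : ℝ ∂(volume.restrict (Set.Ioi 0)),
      (bombieriLagariasTestFun n x : ℂ) * (x : ℂ) ^ (ρ - 1) =
        ∑ j ∈ Finset.Icc 1 n, (n.choose j : ℂ) / ((j - 1).factorial : ℂ) *
          ((x : ℂ) ^ (ρ - 1) • f (j - 1) x) := by
    have h1 : ∀ᵐ x : ℝ ∂(volume.restrict (Set.Ioi 0)), x ∉ ({1} : Set ℝ) :=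
      ae_restrict_of_ae (measure_eq_zero_iff_ae_notMem.1 (measure_singleton (1 : ℝ)))
    filter_upwards [h1, ae_restrict_mem measurableSet_Ioi] with x hx1 hx0
    rw [Set.mem_singleton_iff] at hx1
    rw [Set.mem_Ioi] at hx0
    by_cases hx : x < 1
    · have hmem : x ∈ Set.Ioc (0 : ℝ) 1 := ⟨hx0, hx.le⟩
      simp only [bombieriLagariasTestFun, hx0, hx, and_self, if_true, hf, Set.indicator_of_mem hmem,
        smul_eq_mul]
      push_cast
      rw [Finset.sum_mul]
      refine Finset.sum_congr rfl fun j _ ↦ ?_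
      ring
    · have hgt : 1 < x := lt_of_le_of_ne (not_lt.1 hx) (Ne.symm hx1)
      have hnmem : x ∉ Set.Ioc (0 : ℝ) 1 := fun h ↦ absurd h.2 (not_le.2 hgt)
      simp [bombieriLagariasTestFun, hx, hx1, hf, Set.indicator_of_notMem hnmem]
  rw [integral_congr_ae hae, integral_finsetSum _ fun j _ ↦ ((hM (j - 1)).1.integrable.const_mul _)]
  have hterm : ∀ j ∈ Finset.Icc 1 n,
      ∫ x in Set.Ioi (0 : ℝ), (n.choose j : ℂ) / ((j - 1).factorial : ℂ) *
          ((x : ℂ) ^ (ρ - 1) • f (j - 1) x) =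
        (n.choose j : ℂ) * (-1) ^ (j - 1) * (1 / ρ) ^ j := by
    intro j hj
    have hj1 : 1 ≤ j := (Finset.mem_Icc.1 hj).1
    rw [integral_const_mul]
    have : ∫ x in Set.Ioi (0 : ℝ), (x : ℂ) ^ (ρ - 1) • f (j - 1) x = mellin (f (j - 1)) ρ := rfl
    rw [this, (hM (j - 1)).2, Nat.sub_add_cancel hj1]
    have hfact : ((j - 1).factorial : ℂ) ≠ 0 := by exact_mod_cast (Nat.factorial_pos _).ne'
    rw [one_div_pow]
    field_simp
  rw [Finset.sum_congr rfl hterm, su23b_binom₃]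

/-! ## Proposition 2.3 (4): the pole criterion -/

/-- **[Su23b] Proposition 2.3 (4) (discharge of `Suzuki2023b_prop23_4`)**: if `l ∉ 𝒵` is a zero
of `ξ + ξ′` of order `m ≥ 1` and a zero of `M_n` of order `< m`, then `|H_n(s)| → ∞` as `s → l`.
Near `l`, `H_n = iξM_n/(ξ+ξ′)` (Prop. 2.1 (i)); writing `ξ+ξ′ = (s−l)^m g`, `M_n = (s−l)^k h` with
`g(l), h(l) ≠ 0`, `|H_n(s)| = |iξh/g|(s)·|s−l|^{−(m−k)}`. RH-FREE.
[cite: Suzuki2023b, Prop. 2.3 (4), p. 6 L116–123] -/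
theorem Suzuki2023b_prop23_4_holds : Suzuki2023b_prop23_4 := by
  intro n hn l hl m hm hEord hMord
  have hξl : riemannXi l ≠ 0 := (riemannXi_ne_zero_iff_not_mem l).2 hl
  have hξc : Continuous riemannXi := differentiable_riemannXi.continuous
  have hξ'd : Differentiable ℂ (deriv riemannXi) :=
    (differentiable_riemannXi.contDiff (n := 2)).differentiable_deriv_two
  have hEan : AnalyticAt ℂ (fun s ↦ riemannXi s + deriv riemannXi s) l :=
    (differentiable_riemannXi.analyticAt l).add (hξ'd.analyticAt l)
  have hMan : AnalyticAt ℂ (liModelM n) l := by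
    rw [Complex.analyticAt_iff_eventually_differentiableAt]
    obtain ⟨δ, hδ, -, hsep⟩ := exists_pos_le_norm_sub_of_nontrivialZeros l
    filter_upwards [Metric.ball_mem_nhds l hδ] with w hw
    refine differentiableAt_liModelM hn fun hwZ ↦ ?_
    rcases eq_or_ne w l with rfl | hne
    · exact hl hwZ
    · have h2 := hsep w hwZ hne
      rw [Metric.mem_ball, dist_eq_norm] at hw
      linarith
  -- factorizations at `l`
  obtain ⟨g, hg, hg0, hEfac⟩ := hEan.analyticOrderAt_eq_natCast.1 hEord
  have hMtop : analyticOrderAt (liModelM n) l ≠ ⊤ := by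
    intro h
    rw [h] at hMord
    exact not_top_lt hMord
  obtain ⟨k, hk⟩ := ENat.ne_top_iff_exists.1 hMtop
  obtain ⟨h, hh, hh0, hMfac⟩ := hMan.analyticOrderAt_eq_natCast.1 hk.symm
  have hkm : k < m := by
    rw [← hk] at hMord
    exact_mod_cast hMord
  obtain ⟨e, he⟩ : ∃ e, m = k + e := ⟨m - k, by omega⟩
  have he0 : e ≠ 0 := by omega
  -- `|H_n(s)| = |iξh/g|(s) · |s − l|^{−e}` on a punctured neighbourhood of `l`
  have hev : (fun s ↦ ‖I * riemannXi s * h s / g s‖ * (‖s - l‖ ^ e)⁻¹) =ᶠ[𝓝[≠] l]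
      fun s ↦ ‖liModelH n s‖ := by
    filter_upwards [(hξc.continuousAt.eventually_ne hξl).filter_mono nhdsWithin_le_nhds,
      eventually_xi_add_deriv_ne_zero' l, hEfac.filter_mono nhdsWithin_le_nhds,
      hMfac.filter_mono nhdsWithin_le_nhds, self_mem_nhdsWithin] with s hξs hEs hE hM hne
    simp only [smul_eq_mul] at hE hM
    rw [(Suzuki2023b_prop21_holds n hn).1 s hξs hEs, hM, hE]
    have hsl : s - l ≠ 0 := sub_ne_zero.2 hne
    have hgs : g s ≠ 0 := by
      intro h0
      rw [h0, mul_zero] at hE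
      exact hEs hE
    have : I * riemannXi s / ((s - l) ^ m * g s) * ((s - l) ^ k * h s) =
        I * riemannXi s * h s / g s * ((s - l) ^ e)⁻¹ := by
      rw [he, pow_add]
      field_simp
    rw [this, norm_mul, norm_inv, norm_pow]
  -- the two factors
  have hc : Tendsto (fun s ↦ ‖I * riemannXi s * h s / g s‖) (𝓝[≠] l)
      (𝓝 ‖I * riemannXi l * h l / g l‖) :=
    ((((continuousAt_const.mul hξc.continuousAt).mul hh.continuousAt).div hg.continuousAt
      hg0).norm).mono_left nhdsWithin_le_nhds
  have hCpos : 0 < ‖I * riemannXi l * h l / g l‖ :=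
    norm_pos_iff.2 (div_ne_zero (mul_ne_zero (mul_ne_zero Complex.I_ne_zero hξl) hh0) hg0)
  have hp : Tendsto (fun r : ℝ ↦ r ^ e) (𝓝[>] 0) (𝓝[>] 0) := by
    refine tendsto_nhdsWithin_of_tendsto_nhds_of_eventually_within _ ?_ ?_
    · have : Tendsto (fun r : ℝ ↦ r ^ e) (𝓝 0) (𝓝 0) := by
        simpa [zero_pow he0] using ((continuous_pow e).tendsto (0 : ℝ))
      exact this.mono_left nhdsWithin_le_nhds
    · filter_upwards [self_mem_nhdsWithin] with r hr
      exact pow_pos (Set.mem_Ioi.1 hr) _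
  have hpow : Tendsto (fun s ↦ (‖s - l‖ ^ e)⁻¹) (𝓝[≠] l) atTop :=
    tendsto_inv_nhdsGT_zero.comp (hp.comp (tendsto_norm_sub_self_nhdsNE l))
  exact Filter.Tendsto.congr' hev (hc.pos_mul_atTop hCpos hpow)

/-! ## The values of `H_n` at the zeros, and Proposition 2.3 (2) -/

/-- **The removable values**: at `ρ ∈ 𝒵` the formula (1.4) tends to `1 − (1 − 1/ρ)ⁿ`
(`= ĝ_n(ρ)`): `iξ/(ξ+ξ′) · M_n = i·[ξ/((ξ+ξ′)(s−ρ))]·[(s−ρ)M_n(s)] → i·(1/m_ρ)·(−i m_ρ[1−(1−1/ρ)ⁿ])`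
by (2.9) and Lemma 2.1 (iii). RH-FREE. [cite: Suzuki2023b, Prop. 2.1 (proof), p. 6 L26–38] -/
theorem tendsto_liModelHFormula_of_mem {n : ℕ} (hn : 1 ≤ n) {ρ : ℂ}
    (hρ : ρ ∈ riemannZetaNontrivialZeros) :
    Tendsto (liModelHFormula n) (𝓝[≠] ρ) (𝓝 (1 - (1 - 1 / ρ) ^ n)) := by
  have h212 := Suzuki2023b_eq_s212_holds ρ hρ
  have hres := (Suzuki2023b_lemma21_holds n hn).2.2 ρ hρ
  have hprod := (h212.mul hres).const_mul I
  have hm : (riemannZetaZeroOrder ρ : ℂ) ≠ 0 := by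
    have := FordL33.order_pos ⟨ρ, hρ⟩
    exact_mod_cast this.ne'
  have hval : I * (1 / (riemannZetaZeroOrder ρ : ℂ) *
      (-I * (riemannZetaZeroOrder ρ : ℂ) * (1 - (1 - 1 / ρ) ^ n))) = 1 - (1 - 1 / ρ) ^ n := by
    field_simp
    rw [Complex.I_sq]
    ring
  have hev : (fun w ↦ I * (riemannXi w / ((riemannXi w + deriv riemannXi w) * (w - ρ)) *
        ((w - ρ) * liModelM n w))) =ᶠ[𝓝[≠] ρ] liModelHFormula n := by
    filter_upwards [eventually_ne_nhdsNE ρ 0, eventually_ne_nhdsNE ρ 1,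
      eventually_not_mem_nontrivialZeros ρ, self_mem_nhdsWithin] with w hw0 hw1 hwZ hne
    have hwρ : w - ρ ≠ 0 := sub_ne_zero.mpr hne
    rw [liModelHFormula_eq_mul_liModelM hn hw0 hw1 ((riemannXi_ne_zero_iff_not_mem w).2 hwZ)]
    have : riemannXi w / ((riemannXi w + deriv riemannXi w) * (w - ρ)) *
          ((w - ρ) * liModelM n w) =
        riemannXi w * liModelM n w / (riemannXi w + deriv riemannXi w) := by
      rw [div_mul_eq_mul_div, show riemannXi w * ((w - ρ) * liModelM n w) =
        riemannXi w * liModelM n w * (w - ρ) by ring, mul_div_mul_right _ _ hwρ]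
    rw [this]
    ring
  rw [← hval]
  exact Filter.Tendsto.congr' hev hprod

/-- **`H_n(ρ) = 1 − (1 − 1/ρ)ⁿ` at every `ρ ∈ 𝒵`** (the removable singularities filled by
continuity). RH-FREE. [cite: Suzuki2023b, Prop. 2.1 (proof), p. 6 L26–38] -/
theorem liModelH_of_mem {n : ℕ} (hn : 1 ≤ n) {ρ : ℂ} (hρ : ρ ∈ riemannZetaNontrivialZeros) :
    liModelH n ρ = 1 - (1 - 1 / ρ) ^ n := by
  unfold liModelH
  exact (tendsto_liModelHFormula_of_mem hn hρ).limUnder_eq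

/-- **`H_1(½) = β`** (`= −2ξ′(0)/ξ(0)`; formula (1.8) at `s = ½`, where `ξ′(½) = 0`). RH-FREE.
[cite: Suzuki2023b, eq. (1.8), p. 3; Prop. 2.3 (2) (proof), p. 6 L131–134] -/
theorem liModelH_one_half : liModelH 1 (1 / 2) = (nicolasBeta : ℂ) := by
  have hhalf : (1 / 2 : ℂ) ∉ riemannZetaNontrivialZeros := fun h ↦ by
    have := FordL33.fourteen_lt_abs_im ⟨_, h⟩
    simp at this
    linarith
  have hξ : riemannXi (1 / 2) ≠ 0 := (riemannXi_ne_zero_iff_not_mem _).2 hhalf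
  have hξ' : deriv riemannXi (1 / 2) = 0 := by
    have h := deriv_riemannXi_one_sub (1 / 2 : ℂ)
    norm_num at h
    linear_combination h / 2
  have hE : riemannXi (1 / 2) + deriv riemannXi (1 / 2) ≠ 0 := by rw [hξ', add_zero]; exact hξ
  have hd0 : deriv riemannXi 0 = -(nicolasBeta : ℂ) / 4 := by
    have h := xi_add_deriv_zero
    rw [riemannXi_zero] at h
    linear_combination h
  rw [liModelH_eq_formula_of_ne 1 (by norm_num) (by norm_num) hξ hE]
  unfold liModelHFormula
  rw [Finset.Icc_eq_empty (by norm_num), Finset.sum_empty, hξ', riemannXi_zero, hd0, add_zero,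
    zero_div, div_self hξ]
  ring

/-- **[Su23b] Proposition 2.3 (2) (discharge of `Suzuki2023b_prop23_2`)**, the printed `n = 1`
case: `H_1` is neither real-valued nor purely-imaginary-valued on `Re(s) = ½`. Not real: at a
critical zero `ρ = ½ + it` (one exists by Hardy's theorem, `hardy_infinite_zeros_on_critical_line_holds`)
`H_1(ρ) = 1/ρ` has imaginary part `−t/|ρ|² ≠ 0`. Not purely imaginary: `H_1(½) = β > 0`.
RH-FREE. [cite: Suzuki2023b, Prop. 2.3 (2), p. 6 L106, proof L131–134] -/
theorem Suzuki2023b_prop23_2_holds : Suzuki2023b_prop23_2 := by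
  constructor
  · intro h
    obtain ⟨t, ht⟩ := hardy_infinite_zeros_on_critical_line_holds.nonempty
    have ht' : riemannZeta (1 / 2 + t * I) = 0 := ht
    have hρ : (1 / 2 + t * I : ℂ) ∈ riemannZetaNontrivialZeros :=
      mem_riemannZetaNontrivialZeros_iff_holds.2 ⟨ht', by norm_num, by norm_num⟩
    have ht0 : t ≠ 0 := by
      intro h0
      have := FordL33.fourteen_lt_abs_im ⟨_, hρ⟩
      simp [h0] at this
      linarith
    have hval : liModelH 1 (1 / 2 + t * I) = (1 / 2 + t * I)⁻¹ := by
      rw [liModelH_of_mem le_rfl hρ, pow_one, sub_sub_cancel, one_div]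
    have him := h t
    rw [hval, Complex.inv_im, div_eq_zero_iff, neg_eq_zero] at him
    rcases him with him | hn0
    · simp at him
      exact ht0 him
    · exact FordL33.coe_ne_zero ⟨_, hρ⟩ (Complex.normSq_eq_zero.1 hn0)
  · intro h
    have hre := h 0
    rw [Complex.ofReal_zero, zero_mul, add_zero, liModelH_one_half, Complex.ofReal_re] at hre
    linarith [nicolasBeta_gt]

/-- **`G_n(γ) = 1 − (1 − 1/ρ)ⁿ = ĝ_n(ρ)` at the parameter `γ = i(ρ − ½)` of every `ρ ∈ 𝒵`** (the
interpolation property behind §4.2's `G_n = 𝒯(g_n)`). RH-FREE.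
[cite: Suzuki2023b, §4.2, p. 10 L93–100; Prop. 2.1 (proof), p. 6 L26–38] -/
theorem liModelG_suzukiZeroParam {n : ℕ} (hn : 1 ≤ n) {ρ : ℂ}
    (hρ : ρ ∈ riemannZetaNontrivialZeros) :
    liModelG n (suzukiZeroParam ρ) = 1 - (1 - 1 / ρ) ^ n := by
  rw [liModelG, one_half_sub_I_mul_suzukiZeroParam, liModelH_of_mem hn hρ]

end Literature.NumberTheory.LFunctions
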